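import Literature.MathematicalPhysics.QuantumFieldTheory.Balaban1983to89.T4CombWindowSocket
import Literature.MathematicalPhysics.QuantumFieldTheory.Balaban1983to89.B9Eq335Plaquette
import Literature.MathematicalPhysics.QuantumFieldTheory.Balaban1983to89.B7Prop1Explicit

/-!
# `Balaban1983to89.T4CombPotentialLetters` — the comb → NE1′ socket fed by SIX per-configuration letters, by
# FOUR POTENTIAL letters (the (3.35)-TYPE small-field presentation) and — v1.1 — by FIVE RELATIVE letters
# (the PRODUCT presentation `U₁ = e^{A}·U₀`, the lettering of B8 (1.36) ∕ (1.40)–(1.41))  (v1.1)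

CITATION HEADER (lean-in-tree rule 2026-08-18).  Audit cell `pub-balaban`, lineage pv24 (one writer), T4-DAG §8
Q24(a) self-announced row `T4-O3.E-NE1′-OG1′-POT-LETTERS*` (gen 16), a LEAF above the writer's own
`T4CombWindowSocket` (v1.2, §6: the unit-weight comb socket from SEVEN raw letters at INTEGER rates,
`transportsFrom_of_combRaw₇_eps`), importing BY NAME b09's `B9Eq335Plaquette` (`norm_plaquette_exp_sub_one_le`,
`norm_exp_sub_one_le_mul`, `norm_exp_sub_exp_le_of_le`) and b07's `B7Prop1Explicit` (`expUnit`); nothing landed is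
modified.  Papers in view (all UNDER ADJUDICATION by the cell; NOTHING of them is asserted here):
T. Bałaban, *Propagators for lattice gauge theories in a background field*, Comm. Math. Phys. **99**, 389–434 (1985)
[Balaban1985BackgroundPropagators] (cell paper B9), (3.35) p. 396; T. Bałaban, *Averaging operations for lattice
gauge theories*, Comm. Math. Phys. **98**, 17–51 (1985) [Balaban1985Averaging] (B7), (52) p. 26; T. Bałaban,
*Spaces of regular gauge field configurations on a lattice and gauge fixing conditions*, Comm. Math. Phys. **99**,
75–102 (1985) [Balaban1985RegularSpaces] (B8), Lemma 1 p. 79 (the comb = axial gauge of `T4RelativeComb`).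
NOTHING NEWLY READ in this file: the one printed sentence used for ORIENTATION is a COPY from the certified header
of `B9Eq335Plaquette` (pages re-read as images there): B9 p. 396 «for an arbitrary cube □ of the described above
class, and for a configuration U there exists a gauge transformation u on □ such that U^u = e^{iηA}. and if the
index of □ is j, then |A| < O(1)Mα₀(L^jη)^{-1}, |∇^ηA| < O(1)Mα₀(L^jη)^{-2} on □ … (3.35)».

v1.1 (gen 16, the writer's self-announced row `T4-O3.E-NE1′-OG1′-REL-LETTERS*`): APPEND-ONLY — the code of §§1–3
is v1 (p190940) byte for byte except the two LOW DOCFIXes D1 ∕ D2 of XREAD C-adv9-111 (adv9-g62; docstrings of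
`IsExpOn` and `DictP` only — a mis-spanned guillemet and two `≲`-paraphrases unquoted; no statement, no proof
touched); NEW §4 (the RELATIVE ∕ PRODUCT presentation `U₁ = e^{A}·U₀` of the second configuration over the
background: five relative letters, the relative plaquette lemma, the covariant-gradient converter, the sockets) and
§5 (its non-vacuity), importing BY NAME in addition the tree's `T4DirectionChart`
(`transport`, `basePlaq`, `movedPlaq`, `norm_movedPlaq_sub_one_le`, `GUnit.norm_transport_le`,
`GUnit.norm_transport_sub_self_le`, `GUnit.basePlaq`, `GUnit.path₃`, `path₃_eq_basePlaq_mul`) and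
`T4AxialChain.norm_mul_sub_one_le_add'` (both already below `T4CombWindowSocket`; no new import line).  Two further
printed displays are used for ORIENTATION in §4, both COPIES from the lineage's located-print record
`t4/T4-EST-OG1p-D3.md` §1 (v1.4; read there as images, `b2b-balaban-ref1/pages/1985-cmp99-regular-spaces-gauge-
fixing/…-p008-x2.png`, `…-p009-x2.png`): B8 p. 82 «… such that U₁ = U′^{u^{−1}} satisfies the conditions
U₁ = e^{iηA}, |A| < B₁(α₀+α₁)(L^jη)^{−1}, |∇^η_{U₀}A| < B₁(α₀+α₁)(L^jη)^{−2}, ‖A‖_{1,β} < B₂(β₀)(α₀+α₁)(L^jη)^{−2−β},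
β ≦ β₀ < 1, on Ω_j, j = 0, 1, …, k, (1.36)» and B8 p. 83 «We assume that we have configurations U₀, U₁U₀ satisfying
the following conditions U₀, U₁U₀ ∈ 𝔘_k({Ω_j}, α₀), U₀ satisfies the additional regularity condition (3.35) in [4],
(1.40) U₁ = e^{iηA}, |A| < α₂(L^jη)^{−1} on Ω_j, (1.41)» — TYPE only; NOTHING of them is asserted.

## What this file does (kernel; [folklore] algebra ∕ analysis + (arith); a certificate of FORMAT, NOT summit progress)

§6 of `T4CombWindowSocket` feeds the comb → NE1′ edge (`T.TransportsFrom`) from SEVEN raw block sups of an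
attaining pair `(U₀, U₁)` on the block `B(z)` of side `L` — the comb-gauge-fixed RELATIVE plaquette deviation `s`,
the curvatures `q₀, q₁`, the bond deviations `τ₀, τ₁` and the plain bond gradients `γU, γU₁` — under the
integer-rate `ε`-dictionary `Dict₇E θ ε c C` (`s, q, γU ≤ ε·cθ²`, `τ ≤ ε·cθ`).  Here:

* §1 THE RELATIVE LETTER IS REDUNDANT [folklore]: for a unitary-like unit `g` and units `P₀, P₁`,
  `‖g·P₁·g⁻¹ − P₀‖ ≤ ‖P₀ − 1‖ + ‖P₁ − 1‖` (`norm_conj_sub_le`); since the comb gauge is unitary-like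
  (`T4RelativeComb.unitaryLike_combGauge`) and `plaq (U₁^g) = g·plaq U₁·g⁻¹` (`T4RelativeComb.plaq_gaugeAct`), the
  relative letter obeys `s ≤ q₀ + q₁`: SIX per-configuration letters `Letters₆ = {q₀, q₁, τ₀, τ₁, γU, γU₁}` give the
  seven (`RawSups₆.lift : RawSups₆ → RawSups₇ (s := q₀ + q₁)`, `Dict₆E.lift : Dict₆E θ ε c C → Dict₇E θ ε (2c) C`),
  hence the socket from six letters (`exists_windowData_unit₆_eps`, `transportsFrom_of_combRaw₆_eps`; constant
  `sockConst (16c) Λ`).  In particular the feed no longer mentions the comb gauge at all: every letter is a block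
  sup of ONE configuration.
* §2 POTENTIAL LETTERS [folklore]: if ON THE BLOCK the two configurations are exponentials of potentials,
  `U_i⟨x, x+e_ν⟩ = e^{A_i(x)_ν}` for the bonds of `B(z)` (`IsExpOn L z U A`, with b07's unit `expUnit`; the shape of
  (3.35)'s presentation `U^u = e^{iηA}`, the gauge being the feed provider's business exactly as for the bond letters
  `τ` of §6 — cell caveat (u5) of GAPS G-pv24g13-1, now EXPLICIT as the hypothesis shape), and the potentials
  have block sups `‖A_i(x)_ν‖ ≤ a_i` and PLAIN lattice gradients `‖A_i(x+e_μ)_ν − A_i(x)_ν‖ ≤ g_i` (FOUR letters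
  `PotLetters = {a₀, g₀, a₁, g₁}`, `PotSups`), then (any complete normed `ℂ`-algebra with `‖1‖ = 1`)
  `τ_i ≤ a_i e^{a_i}` (`B9Eq335Plaquette.norm_exp_sub_one_le_mul`), `γU_i ≤ g_i e^{a_i}`
  (`B9Eq335Plaquette.norm_exp_sub_exp_le_of_le`) and `q_i ≤ 2(g_i + a_i²)e^{4a_i}`
  (`B9Eq335Plaquette.norm_plaquette_exp_sub_one_le` BY NAME — b09's B9 (3.35) ⇒ B7 (52) plaquette step):
  `RawSups₆.of_pot`.  (arith) Under the potential `ε`-dictionary `DictPE θ ε c C` (`a_i ≤ ε·cθ`, `g_i ≤ ε·cθ²`,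
  `0 < ε ≤ 1`, `0 < θ ≤ 1 ≤ c`) the derived six letters obey `Dict₆E θ ε (potConst c) C` with
  `potConst c = 2c(1+c)e^{4c}` (b09's constant `α₀′ = 2C(1+C)e^{4C}` of `b7_52_of_b9_335`): `DictPE.lift`.  Hence
  **`transportsFrom_of_combPot_eps`** and the K-uniform end-to-end corollary
  **`latticeTrajectory_budget_combPot_eps_strict`**: the comb → NE1′ edge, and the whole T4 lattice chain behind it,
  fed per attaining pair by FOUR potential letters at the rates `(θ, θ², θ, θ²)·ε`, `θ = ϑ^{k−k′}` — the printed
  TYPE of (3.35) (`|A| ≲ (scale ratio)`, `|∇A| ≲ (scale ratio)²`) for BOTH configurations, the small-field parameter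
  carried by `ε`.
* §3 non-vacuity: zero potentials (`U_i ≡ expUnit 0`) satisfy every hypothesis with all letters `0`.
* §4 RELATIVE (PRODUCT) LETTERS [folklore] (v1.1) — the printed LETTERING of B8 (1.36) ∕ (1.40)–(1.41): the second
  configuration presented ON THE BLOCK over the background as `U₁⟨x,x+e_ν⟩ = e^{A(x)_ν}·U₀⟨x,x+e_ν⟩` (`IsExpRelOn`;
  in the tree's lettering `U₁` is the FULL second configuration, print's `U₁U₀`), with FIVE letters
  `RelLetters = {q₀, τ₀, γU₀, a, g}`: the background's three raw block sups (the (1.7) ∕ (3.35)-TYPE data of `U₀`,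
  VERBATIM the `U₀`-fields of `RawSups₆`) and the relative potential's sup `‖A‖ ≤ a` and lattice gradient `≤ g`
  (`RelSups`, PLAIN gradient; `RelSupsCov`, the COVARIANT gradient `‖U₀(b)·A(x+e_μ)_ν·U₀(b)⁻¹ − A(x)_ν‖` over the
  background, `T4DirectionChart.transport` — the TYPE of (1.36)'s `|∇^η_{U₀}A|`).  Then `τ₁ ≤ a e^{a} + τ₀`
  (`relBond_le`), `γU₁ ≤ g e^{a} + e^{a}γU₀` (`relGrad_le`, the product rule) and — by the tree's COVARIANT TRANSPORT
  IDENTITY `plaq (e^{A}U₀) = e^{Ã₁}e^{Ã₂}e^{−Ã₃}e^{−Ã₄}·plaq U₀`, the potentials transported to the base point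
  (`T4DirectionChart.movedPlaq_eq` ∕ `norm_movedPlaq_sub_one_le`), transports by unitary-likes costing
  `≤ 2‖u − 1‖·‖X‖` (`GUnit.norm_transport_sub_self_le`), and b09's `norm_plaquette_exp_sub_one_le`, all BY NAME —
  `q₁ ≤ q₀ + 2((g + 2a(q₀+τ₀)) + a²)e^{4a}` (`norm_relPlaq_sub_one_le`, `relCurv_le`): `RawSups₆.of_rel`.  The
  covariant gradient gives the plain one at the same order, `g ↦ g + 2aτ₀` (`RelSupsCov.toRelSups` — cell question
  (u1) in kernel for this presentation).  (arith) The relative `ε`-dictionary `DictRE θ ε c C` (`q₀, γU₀, g ≤ ε·cθ²`,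
  `τ₀, a ≤ ε·cθ`) gives `Dict₆E θ ε (relConst c) C`, `relConst c = 2·potConst (c(1+4c))` (`DictRE.lift`), and
  survives the covariant conversion at `c ↦ c(1+2c)` (`DictRE.plainOfCov`).  Hence **`transportsFrom_of_combRel_eps`**,
  **`transportsFrom_of_combRelCov_eps`** and the K-uniform corollary **`latticeTrajectory_budget_combRel_eps_strict`**:
  the comb → NE1′ edge fed per attaining pair by the background's (1.7) ∕ (3.35)-type letters and the relative
  potential's (1.41) ∕ (1.36)-type letters at the rates `(θ², θ, θ², θ, θ²)·ε`, `θ = ϑ^{k−k′}`.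
* §5 non-vacuity of §4: `U₀ ≡ 1`, `U₁ ≡ e^{0}·1`, `A ≡ 0`, all letters `0`; and the chain of sockets
  covariant-relative ⟹ relative ⟹ six ⟹ seven letters.

## Honest scope (what is NOT done)

* This changes the CURRENCY of the feed (group-valued block sups ↦ Lie-algebra-valued potentials with sup and
  plain-gradient bounds); it asserts NOTHING of print.  Whether Bałaban's small-field configurations of history depth
  `k − k′` admit, on the consumer's blocks and in ONE gauge compatible with the consumer's domain `𝒦`, potentials
  obeying `DictPE (ϑ^{k−k′}) ε c` is the (I4′)-type consumer INPUT (W2) of GAPS G-pv24g15-1 ∕ G-pv24g16-1, restated —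
  NOT discharged.  The gradient letter is the PLAIN lattice gradient; (3.35)'s `∇^η` may be the covariant one
  (cell question (u1) ∕ (S2); `B9Eq335Plaquette`'s header quantifies the difference, same order) — unchanged.
* Unitarity-likeness of the bond variables stays a HYPOTHESIS (`unit₀`, `unit₁`), not derived from the potentials
  (for `G ⊂ U(N)` and anti-Hermitian `A` it would follow from `NormedSpace.exp_mem_unitary_of_mem_skewAdjoint`; not
  needed here).  Constants (`2c`, `potConst c`, `16`) are generous and not optimised.  Readings (A)∕(B) of the
  NE1′ node and B11 Thm 1 (9) are untouched.
* (v1.1) §4 changes the CURRENCY once more (two independent exponential presentations ↦ the background's letters +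
  ONE relative potential in the product form, the lettering of (1.36) ∕ (1.40)–(1.41)); it asserts NOTHING of print.
  Whether Bałaban's attaining pairs of history depth `k − k′` admit, on the consumer's blocks and in one gauge
  compatible with `𝒦`, such a presentation with letters obeying `DictRE (ϑ^{k−k′}) ε c` is the consumer INPUT (W2″)
  of GAPS G-pv24g16-2 ∕ -2a in the printed lettering — NOT discharged ((1.36) is the CONCLUSION of B8 Theorem 2 for
  the gauge-transformed `U′^{u^{−1}}`, (1.41) a HYPOTHESIS of B8 §1's second problem; which of them the consumer's
  attaining pairs carry, and at which `j` relative to the consumer block, is exactly (W2″)).  v1's phrase "for BOTH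
  configurations" (§2 bullet above) describes the HYPOTHESIS SHAPE `IsExpOn` ∕ `PotSups` of §2, not print: (1.40)
  prints the (3.35)-type presentation for `U₀` only and the PRODUCT form for the second configuration (GAPS
  G-pv24g16-2a) — §4 is that product form.  The covariant-gradient convention of `RelSupsCov` (`u·X·u⁻¹` along the
  bond, transported back to `x`) is the cell's (`T4DirectionChart.covSum'`); print's `∇^η_{U₀}` is not re-read.
  `unit₀` ∕ `unit₁` stay hypotheses; constants (`relConst`, `c(1+2c)`, `16`) generous.

Value = kernel certificate that the comb → NE1′ socket is fed by (3.35)-TYPE data and — v1.1 — by (1.36) ∕ (1.40)-TYPE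
RELATIVE data; NOT summit progress.
-/

namespace Literature.MathematicalPhysics.QuantumFieldTheory.Balaban1983to89.T4CombPotentialLetters

open NormedSpace
open Literature.MathematicalPhysics.QuantumFieldTheory.Balaban1983to89.T4TermFormat
open Literature.MathematicalPhysics.QuantumFieldTheory.Balaban1983to89.T4TermFormat.Booking
open Literature.MathematicalPhysics.QuantumFieldTheory.Balaban1983to89.T4GatedBooking
open Literature.MathematicalPhysics.QuantumFieldTheory.Balaban1983to89.T4PreservedUnderT
open B8Lemma1Lattice (e InBlock)
open T4RelativeLadder (UnitaryLike norm_mul_unit_le norm_unit_mul_le)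
open T4RelativeComb (Cfg gaugeAct plaq plaq_gaugeAct combGauge unitaryLike_combGauge PlaqSup)
open T4CombHolderWindow (Win winN WindowData blockDev wMove wN)
open T4CombWindowSocket (Letters₇ RawSups₇ Dict₇ Dict₇E unitWin sockConst sockConst_nonneg
  exists_windowData_unit₇_eps transportsFrom_of_combRaw₇_eps)
open T4BlockTransport (Fld val BlockRel)
open T4BirthChartTransport (GaugeInvariant BirthSlice)
open T4TrajectoryComparison (Trajectory RanBelow)
open B7Prop1Explicit (expUnit val_expUnit val_inv_expUnit)

variable {R : Type*} [NormedRing R] {d : ℕ}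

/-- [folklore] Sites of the `d`-dimensional lattice (= `B8Lemma1Lattice.Site`, `T4CombWindowSocket.Site`). -/
abbrev Site (d : ℕ) : Type := Fin d → ℤ

/-! ## §1  [folklore] The relative letter is redundant: the socket from SIX per-configuration letters -/

section Six

/-- [folklore] CONJUGATION BY A UNITARY-LIKE UNIT COSTS NOTHING: `‖g·P₁·g⁻¹ − P₀‖ ≤ ‖P₀ − 1‖ + ‖P₁ − 1‖`
(`g·P₁·g⁻¹ − P₀ = g(P₁ − 1)g⁻¹ + (1 − P₀)` and `‖g‖, ‖g⁻¹‖ ≤ 1`). -/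
theorem norm_conj_sub_le {g P₁ P₀ : Rˣ} (hg : UnitaryLike g) :
    ‖((g * P₁ * g⁻¹ : Rˣ) : R) - P₀‖ ≤ ‖(P₀ : R) - 1‖ + ‖(P₁ : R) - 1‖ := by
  have e : ((g * P₁ * g⁻¹ : Rˣ) : R) - P₀
      = (g : R) * ((P₁ : R) - 1) * ((g⁻¹ : Rˣ) : R) + (1 - (P₀ : R)) := by
    rw [mul_sub, sub_mul, mul_one, Units.mul_inv, Units.val_mul, Units.val_mul]; abel
  rw [e]
  calc ‖(g : R) * ((P₁ : R) - 1) * ((g⁻¹ : Rˣ) : R) + (1 - (P₀ : R))‖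
      ≤ ‖(g : R) * ((P₁ : R) - 1) * ((g⁻¹ : Rˣ) : R)‖ + ‖1 - (P₀ : R)‖ := norm_add_le _ _
    _ ≤ ‖(P₁ : R) - 1‖ + ‖(P₀ : R) - 1‖ := by
        rw [norm_sub_rev (1 : R)]
        exact add_le_add ((norm_mul_unit_le hg.inv _).trans (norm_unit_mul_le hg _)) le_rfl
    _ = ‖(P₀ : R) - 1‖ + ‖(P₁ : R) - 1‖ := add_comm _ _

variable [NormOneClass R]

/-- [folklore] THE SIX PER-CONFIGURATION FIRST-ORDER LETTERS: curvatures `q₀, q₁`, bond deviations `τ₀, τ₁`, plain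
bond gradients `γU, γU₁` (the seven letters `Letters₇` without the relative letter `s`). -/
structure Letters₆ where
  /-- curvature sup of `U₀` -/
  q₀ : ℝ
  /-- curvature sup of `U₁` -/
  q₁ : ℝ
  /-- bond deviation sup of `U₀` -/
  τ₀ : ℝ
  /-- bond deviation sup of `U₁` -/
  τ₁ : ℝ
  /-- plain bond gradient sup of `U₀` -/
  γU : ℝ
  /-- plain bond gradient sup of `U₁` -/
  γU₁ : ℝ

/-- [folklore] All six letters nonnegative. -/
structure Letters₆.Nonneg (ℓ : Letters₆) : Prop where
  hq₀ : 0 ≤ ℓ.q₀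
  hq₁ : 0 ≤ ℓ.q₁
  hτ₀ : 0 ≤ ℓ.τ₀
  hτ₁ : 0 ≤ ℓ.τ₁
  hγU : 0 ≤ ℓ.γU
  hγU₁ : 0 ≤ ℓ.γU₁

/-- [folklore] THE DERIVED SEVEN LETTERS: relative letter `s := q₀ + q₁` (`norm_conj_sub_le`), the six others
verbatim. -/
def Letters₆.lift₇ (ℓ : Letters₆) : Letters₇ := ⟨ℓ.q₀ + ℓ.q₁, ℓ.q₀, ℓ.q₁, ℓ.τ₀, ℓ.τ₁, ℓ.γU, ℓ.γU₁⟩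

/-- [folklore] The derived seven letters of nonnegative six letters are nonnegative. -/
theorem Letters₆.Nonneg.lift₇ {ℓ : Letters₆} (h : ℓ.Nonneg) : ℓ.lift₇.Nonneg :=
  ⟨add_nonneg h.hq₀ h.hq₁, h.hq₀, h.hq₁, h.hτ₀, h.hτ₁, h.hγU, h.hγU₁⟩

variable {L : ℕ} {z : Site d}

/-- [folklore] THE SIX RAW BLOCK SUPS of a pair `(U₀, U₁)` on the block `B(z)` of side `L`: the fields `unit₀`,
`unit₁`, `curv₀`, `curv₁`, `bond₀`, `bond₁`, `gradU₀`, `gradU₁` of `T4CombWindowSocket.RawSups₇` VERBATIM (the field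
`dev` — the comb-gauge-fixed relative plaquette deviation — DELETED) and the six letters `≥ 0`.  Every field is a
block sup of ONE configuration; no gauge appears. -/
structure RawSups₆ (L : ℕ) (z : Site d) (U₀ U₁ : Cfg d R) (ℓ : Letters₆) : Prop where
  unit₀ : ∀ x ν, UnitaryLike (U₀ x ν)
  unit₁ : ∀ x ν, UnitaryLike (U₁ x ν)
  curv₀ : PlaqSup L z (fun y ρ ν => ‖(plaq U₀ y ρ ν : R) - 1‖) ℓ.q₀
  curv₁ : PlaqSup L z (fun y ρ ν => ‖(plaq U₁ y ρ ν : R) - 1‖) ℓ.q₁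
  bond₀ : ∀ x ρ, InBlock L z x → InBlock L z (x + e ρ) → ‖(U₀ x ρ : R) - 1‖ ≤ ℓ.τ₀
  bond₁ : ∀ x ρ, InBlock L z x → InBlock L z (x + e ρ) → ‖(U₁ x ρ : R) - 1‖ ≤ ℓ.τ₁
  gradU₀ : ∀ μ x ρ, InBlock L z x → InBlock L z (x + e ρ) → InBlock L z (x + e μ) →
    InBlock L z (x + e μ + e ρ) → ‖(U₀ (x + e μ) ρ : R) - U₀ x ρ‖ ≤ ℓ.γU
  gradU₁ : ∀ μ x ρ, InBlock L z x → InBlock L z (x + e ρ) → InBlock L z (x + e μ) →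
    InBlock L z (x + e μ + e ρ) → ‖(U₁ (x + e μ) ρ : R) - U₁ x ρ‖ ≤ ℓ.γU₁
  nonneg : ℓ.Nonneg

/-- **SIX RAW BLOCK SUPS GIVE SEVEN** [folklore]: the comb-gauge-fixed relative plaquette deviation is bounded by
`q₀ + q₁` — `plaq (U₁^g) = g·plaq U₁·g⁻¹` (`T4RelativeComb.plaq_gaugeAct`), the comb gauge is unitary-like
(`T4RelativeComb.unitaryLike_combGauge`), and `norm_conj_sub_le`. -/
theorem RawSups₆.lift {U₀ U₁ : Cfg d R} {ℓ : Letters₆} (h : RawSups₆ L z U₀ U₁ ℓ) :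
    RawSups₇ L z U₀ U₁ ℓ.lift₇ where
  unit₀ := h.unit₀
  unit₁ := h.unit₁
  dev := by
    intro y ρ ν hρν h1 h2 h3 h4
    show ‖(plaq (gaugeAct (combGauge U₀ U₁ z) U₁) y ρ ν : R) - plaq U₀ y ρ ν‖ ≤ ℓ.q₀ + ℓ.q₁
    rw [plaq_gaugeAct]
    exact (norm_conj_sub_le (unitaryLike_combGauge h.unit₀ h.unit₁ z y)).trans
      (add_le_add (h.curv₀ y ρ ν hρν h1 h2 h3 h4) (h.curv₁ y ρ ν hρν h1 h2 h3 h4))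
  curv₀ := h.curv₀
  curv₁ := h.curv₁
  bond₀ := h.bond₀
  bond₁ := h.bond₁
  gradU₀ := h.gradU₀
  gradU₁ := h.gradU₁
  nonneg := h.nonneg.lift₇

/-- [folklore] (cell reading, NOT print) THE SIX-LETTER DICTIONARY at `θ`: `C ≤ c`, `q₀, q₁, γU, γU₁ ≤ cθ²`,
`τ₀, τ₁ ≤ cθ` (the fields of `T4CombWindowSocket.Dict₇` without `dev`).  NOT asserted for Bałaban's
configurations. -/
structure Dict₆ (θ c C : ℝ) (ℓ : Letters₆) : Prop where
  count : C ≤ c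
  curv₀ : ℓ.q₀ ≤ c * θ ^ 2
  curv₁ : ℓ.q₁ ≤ c * θ ^ 2
  bond₀ : ℓ.τ₀ ≤ c * θ
  bond₁ : ℓ.τ₁ ≤ c * θ
  gradU₀ : ℓ.γU ≤ c * θ ^ 2
  gradU₁ : ℓ.γU₁ ≤ c * θ ^ 2

/-- [folklore] (cell reading, NOT print) THE SIX-LETTER DICTIONARY WITH THE SMALL-FIELD PARAMETER `ε`: `C ≤ c` and the
six letters `≤ ε·`(the bounds of `Dict₆`).  NOT asserted for Bałaban's configurations. -/
structure Dict₆E (θ ε c C : ℝ) (ℓ : Letters₆) : Prop where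
  count : C ≤ c
  curv₀ : ℓ.q₀ ≤ ε * (c * θ ^ 2)
  curv₁ : ℓ.q₁ ≤ ε * (c * θ ^ 2)
  bond₀ : ℓ.τ₀ ≤ ε * (c * θ)
  bond₁ : ℓ.τ₁ ≤ ε * (c * θ)
  gradU₀ : ℓ.γU ≤ ε * (c * θ ^ 2)
  gradU₁ : ℓ.γU₁ ≤ ε * (c * θ ^ 2)

/-- [folklore] At `ε = 1` the six-letter `ε`-dictionary is the six-letter dictionary. -/
theorem dict₆E_one_iff {θ c C : ℝ} {ℓ : Letters₆} : Dict₆E θ 1 c C ℓ ↔ Dict₆ θ c C ℓ := by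
  constructor
  · rintro ⟨h0, h1, h2, h3, h4, h5, h6⟩
    exact ⟨h0, by simpa using h1, by simpa using h2, by simpa using h3, by simpa using h4, by simpa using h5,
      by simpa using h6⟩
  · rintro ⟨h0, h1, h2, h3, h4, h5, h6⟩
    exact ⟨h0, by simpa using h1, by simpa using h2, by simpa using h3, by simpa using h4, by simpa using h5,
      by simpa using h6⟩

/-- [folklore] (arith) THE SIX-LETTER DICTIONARY GIVES THE SEVEN-LETTER ONE at the constant `2c` (`s = q₀ + q₁ ≤ 2cθ²`;
`0 ≤ θ`, `0 ≤ c`). -/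
theorem Dict₆.lift {θ c C : ℝ} {ℓ : Letters₆} (hθ : 0 ≤ θ) (hc : 0 ≤ c) (h : Dict₆ θ c C ℓ) :
    Dict₇ θ (2 * c) C ℓ.lift₇ := by
  have hθ2 : 0 ≤ c * θ ^ 2 := mul_nonneg hc (pow_nonneg hθ 2)
  have hθ1 : 0 ≤ c * θ := mul_nonneg hc hθ
  refine ⟨h.count.trans (by linarith), ?_, ?_, ?_, ?_, ?_, ?_, ?_⟩
  · show ℓ.q₀ + ℓ.q₁ ≤ 2 * c * θ ^ 2
    linarith [h.curv₀, h.curv₁]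
  · show ℓ.q₀ ≤ 2 * c * θ ^ 2
    linarith [h.curv₀]
  · show ℓ.q₁ ≤ 2 * c * θ ^ 2
    linarith [h.curv₁]
  · show ℓ.τ₀ ≤ 2 * c * θ
    linarith [h.bond₀]
  · show ℓ.τ₁ ≤ 2 * c * θ
    linarith [h.bond₁]
  · show ℓ.γU ≤ 2 * c * θ ^ 2
    linarith [h.gradU₀]
  · show ℓ.γU₁ ≤ 2 * c * θ ^ 2
    linarith [h.gradU₁]

/-- [folklore] (arith) THE SIX-LETTER `ε`-DICTIONARY GIVES THE SEVEN-LETTER ONE at the constant `2c` (`0 ≤ ε`, `0 ≤ θ`,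
`0 ≤ c`). -/
theorem Dict₆E.lift {θ ε c C : ℝ} {ℓ : Letters₆} (hε : 0 ≤ ε) (hθ : 0 ≤ θ) (hc : 0 ≤ c) (h : Dict₆E θ ε c C ℓ) :
    Dict₇E θ ε (2 * c) C ℓ.lift₇ := by
  have hθ2 : 0 ≤ ε * (c * θ ^ 2) := mul_nonneg hε (mul_nonneg hc (pow_nonneg hθ 2))
  have hθ1 : 0 ≤ ε * (c * θ) := mul_nonneg hε (mul_nonneg hc hθ)
  have e2 : ε * (2 * c * θ ^ 2) = 2 * (ε * (c * θ ^ 2)) := by ring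
  have e1 : ε * (2 * c * θ) = 2 * (ε * (c * θ)) := by ring
  refine ⟨h.count.trans (by linarith), ?_, ?_, ?_, ?_, ?_, ?_, ?_⟩
  · show ℓ.q₀ + ℓ.q₁ ≤ ε * (2 * c * θ ^ 2)
    linarith [h.curv₀, h.curv₁]
  · show ℓ.q₀ ≤ ε * (2 * c * θ ^ 2)
    linarith [h.curv₀]
  · show ℓ.q₁ ≤ ε * (2 * c * θ ^ 2)
    linarith [h.curv₁]
  · show ℓ.τ₀ ≤ ε * (2 * c * θ)
    linarith [h.bond₀]
  · show ℓ.τ₁ ≤ ε * (2 * c * θ)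
    linarith [h.bond₁]
  · show ℓ.γU ≤ ε * (2 * c * θ ^ 2)
    linarith [h.gradU₀]
  · show ℓ.γU₁ ≤ ε * (2 * c * θ ^ 2)
    linarith [h.gradU₁]

/-- [folklore] THE PER-PAIR PRODUCER FROM SIX RAW SUPS: six raw block sups + the six-letter `ε`-dictionary at `θ`
(`0 < ε ≤ 1`, `0 < θ ≤ 1 ≤ c`, `0 ≤ β ≤ 1`, `0 ≤ (d−1)(L−1)`, `L ≤ Λ`, `1 ≤ Λ`) ⟹ SOME window data `b_w` of the
comb-gauge block deviation with `N_{(1,1,1)}(b_w) ≤ ε·sockConst (16c) Λ·θ²`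
(`T4CombWindowSocket.exists_windowData_unit₇_eps` on `RawSups₆.lift`, `Dict₆E.lift`). -/
theorem exists_windowData_unit₆_eps {U₀ U₁ : Cfg d R} {β θ ε c Λ : ℝ} {ℓ : Letters₆} (hε : 0 < ε) (hε1 : ε ≤ 1)
    (hθ : 0 < θ) (hθ1 : θ ≤ 1) (hβ0 : 0 ≤ β) (hβ1 : β ≤ 1) (hc1 : 1 ≤ c) (hΛ : 1 ≤ Λ) (hL : (L : ℝ) ≤ Λ)
    (hC0 : 0 ≤ ((d : ℝ) - 1) * ((L : ℝ) - 1)) (h : RawSups₆ L z U₀ U₁ ℓ)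
    (hD : Dict₆E θ ε c (((d : ℝ) - 1) * ((L : ℝ) - 1)) ℓ) :
    ∃ bw : Win, WindowData L z β (blockDev L z (combGauge U₀ U₁ z) U₀ U₁) bw ∧
      winN unitWin bw ≤ ε * sockConst (16 * c) Λ * θ ^ 2 := by
  have h2c : (1 : ℝ) ≤ 2 * c := by linarith
  have key := exists_windowData_unit₇_eps hε hε1 hθ hθ1 hβ0 hβ1 h2c hΛ hL hC0 h.lift
    (hD.lift hε.le hθ.le (by linarith))
  rwa [show (8 : ℝ) * (2 * c) = 16 * c by ring] at key

end Six

section SixSocket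

variable [NormOneClass R] [NormedAlgebra ℂ R] {F : Type*} [NormedAddCommGroup F] [NormedSpace ℂ F] [CompleteSpace F]
variable {B : Booking} {T : Trajectory B}

/-- **THE SIX-LETTER COMB-RAW FEED ⟹ `TransportsFrom`** [folklore] (= `T4CombWindowSocket.transportsFrom_of_combRaw₇_
eps` at the constant `2c`, the feed mapped through `RawSups₆.lift` ∕ `Dict₆E.lift`; weights `(1,1,1)`,
`c_δ = ε·sockConst (16c) Λ`, `ψ = ϑ²`).  The feed asks, per attaining pair, only for SIX per-configuration block sups
`RawSups₆ (Lg b k′) (zg b k′) U₀ U₁ ℓ` (unitary-like pair; curvatures, bond deviations, plain bond gradients — no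
relative quantity, no gauge) obeying `Dict₆E (ϑ^{k−k′}) ε c ((d−1)(Lg b k′−1)) ℓ`; window hypothesis
`ε·sockConst (16c) Λ ≤ w`.  NOT asserted for the cell's terms: every input is a binder. -/
theorem transportsFrom_of_combRaw₆_eps {Gate : ℕ → Prop} {Fn : B.Birth → ℕ → Fld d R → F}
    {Lg : B.Birth → ℕ → ℕ} {zg : B.Birth → ℕ → Site d} {𝒦 : B.Birth → ℕ → Set (Fld d R)}
    {β : ℝ} {w r ε c Λ ϑ : ℝ}
    (hinv : ∀ b k', GaugeInvariant (BlockRel (Lg b k') (zg b k')) (Fn b k'))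
    (hsl : ∀ b k', BirthSlice (Fn b k') (wMove (Lg b k') (zg b k') β) (wN (Lg b k') (zg b k') β unitWin) (𝒦 b k')
      w r (T.gen b k'))
    (hr : 0 < r) (hε : 0 < ε) (hε1 : ε ≤ 1) (hβ0 : 0 ≤ β) (hβ1 : β ≤ 1) (hc1 : 1 ≤ c) (hΛ : 1 ≤ Λ) (hϑ : 0 < ϑ)
    (hϑ1 : ϑ ≤ 1) (hw : ε * sockConst (16 * c) Λ ≤ w) (hL : ∀ b k', (Lg b k' : ℝ) ≤ Λ)
    (hCnn : ∀ b k', 0 ≤ ((d : ℝ) - 1) * ((Lg b k' : ℝ) - 1))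
    (hCc : ∀ b k', ((d : ℝ) - 1) * ((Lg b k' : ℝ) - 1) ≤ c)
    (hfeed : ∀ (b : B.Birth) (k' k : ℕ), B.birthScale b ≤ k' → k' ≤ k → k ≤ B.K → RanBelow Gate k → ∀ ε' > 0,
      ∃ U₀ U₁ : Cfg d R, ∃ ℓ : Letters₆, val U₀ ∈ 𝒦 b k' ∧ RawSups₆ (Lg b k') (zg b k') U₀ U₁ ℓ ∧
        Dict₆E (ϑ ^ (k - k')) ε c (((d : ℝ) - 1) * ((Lg b k' : ℝ) - 1)) ℓ ∧
        T.lin b k' k ≤ ‖Fn b k' (val U₁) - Fn b k' (val U₀)‖ + ε') :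
    T.TransportsFrom (4 * (ε * sockConst (16 * c) Λ) / r) (ϑ ^ 2) Gate := by
  have h2c : (1 : ℝ) ≤ 2 * c := by linarith
  have e16 : (8 : ℝ) * (2 * c) = 16 * c := by ring
  have hw' : ε * sockConst (8 * (2 * c)) Λ ≤ w := by rwa [e16]
  have hCc' : ∀ b k', ((d : ℝ) - 1) * ((Lg b k' : ℝ) - 1) ≤ 2 * c :=
    fun b k' => (hCc b k').trans (by linarith)
  have hfeed' : ∀ (b : B.Birth) (k' k : ℕ), B.birthScale b ≤ k' → k' ≤ k → k ≤ B.K → RanBelow Gate k → ∀ ε' > 0,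
      ∃ U₀ U₁ : Cfg d R, ∃ ℓ : Letters₇, val U₀ ∈ 𝒦 b k' ∧ RawSups₇ (Lg b k') (zg b k') U₀ U₁ ℓ ∧
        Dict₇E (ϑ ^ (k - k')) ε (2 * c) (((d : ℝ) - 1) * ((Lg b k' : ℝ) - 1)) ℓ ∧
        T.lin b k' k ≤ ‖Fn b k' (val U₁) - Fn b k' (val U₀)‖ + ε' := by
    intro b k' k hbk' hk'k hk hran ε' hε'
    obtain ⟨U₀, U₁, ℓ, hK, hR, hD, hle⟩ := hfeed b k' k hbk' hk'k hk hran ε' hε'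
    exact ⟨U₀, U₁, ℓ.lift₇, hK, hR.lift, hD.lift hε.le (pow_nonneg hϑ.le _) (by linarith), hle⟩
  have key := transportsFrom_of_combRaw₇_eps hinv hsl hr hε hε1 hβ0 hβ1 h2c hΛ hϑ hϑ1 hw' hL hCnn hCc' hfeed'
  rwa [e16] at key

end SixSocket

/-! ## §2  [folklore] POTENTIAL LETTERS: the socket fed by the (3.35)-TYPE small-field presentation -/

section Pot

variable [NormOneClass R] [NormedAlgebra ℂ R] [CompleteSpace R]

/-- [folklore] HYPOTHESIS SHAPE — EXPONENTIAL PRESENTATION ON THE BLOCK: every bond variable of the block `B(z)`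
(both endpoints in the block) is the exponential of the potential, `U⟨x, x+e_ν⟩ = e^{A(x)_ν}` (b07's unit
`B7Prop1Explicit.expUnit`, inverse `e^{−A(x)_ν}`).  The shape of (3.35)'s «U^u = e^{iηA}» on □ in a gauge chosen by
the feed provider; NOT asserted for any configuration of the papers. -/
def IsExpOn (L : ℕ) (z : Site d) (U : Cfg d R) (A : Site d → Fin d → R) : Prop :=
  ∀ x ν, InBlock L z x → InBlock L z (x + e ν) → U x ν = expUnit (A x ν)

/-- [folklore] THE FOUR POTENTIAL LETTERS: block sups `a₀, a₁` and plain lattice gradient sups `g₀, g₁` of the two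
potentials. -/
structure PotLetters where
  /-- block sup of `‖A₀‖` -/
  a₀ : ℝ
  /-- block sup of the plain lattice gradient of `A₀` -/
  g₀ : ℝ
  /-- block sup of `‖A₁‖` -/
  a₁ : ℝ
  /-- block sup of the plain lattice gradient of `A₁` -/
  g₁ : ℝ

/-- [folklore] All four potential letters nonnegative. -/
structure PotLetters.Nonneg (p : PotLetters) : Prop where
  ha₀ : 0 ≤ p.a₀
  hg₀ : 0 ≤ p.g₀
  ha₁ : 0 ≤ p.a₁
  hg₁ : 0 ≤ p.g₁

/-- [folklore] THE DERIVED SIX LETTERS of four potential letters: `q_i := 2(g_i + a_i²)e^{4a_i}`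
(`B9Eq335Plaquette.norm_plaquette_exp_sub_one_le`), `τ_i := a_i e^{a_i}` (`B9Eq335Plaquette.norm_exp_sub_one_le_mul`),
`γU_i := g_i e^{a_i}` (`B9Eq335Plaquette.norm_exp_sub_exp_le_of_le`). -/
noncomputable def PotLetters.lift₆ (p : PotLetters) : Letters₆ :=
  ⟨2 * (p.g₀ + p.a₀ ^ 2) * Real.exp (4 * p.a₀), 2 * (p.g₁ + p.a₁ ^ 2) * Real.exp (4 * p.a₁),
    p.a₀ * Real.exp p.a₀, p.a₁ * Real.exp p.a₁, p.g₀ * Real.exp p.a₀, p.g₁ * Real.exp p.a₁⟩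

/-- [folklore] The derived six letters of nonnegative potential letters are nonnegative. -/
theorem PotLetters.Nonneg.lift₆ {p : PotLetters} (h : p.Nonneg) : p.lift₆.Nonneg :=
  ⟨mul_nonneg (mul_nonneg (by norm_num) (add_nonneg h.hg₀ (sq_nonneg _))) (Real.exp_pos _).le,
    mul_nonneg (mul_nonneg (by norm_num) (add_nonneg h.hg₁ (sq_nonneg _))) (Real.exp_pos _).le,
    mul_nonneg h.ha₀ (Real.exp_pos _).le, mul_nonneg h.ha₁ (Real.exp_pos _).le,
    mul_nonneg h.hg₀ (Real.exp_pos _).le, mul_nonneg h.hg₁ (Real.exp_pos _).le⟩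

variable {L : ℕ} {z : Site d}

/-- [folklore] THE FOUR RAW POTENTIAL SUPS on the block `B(z)` of side `L`: `‖A_i(x)_ν‖ ≤ a_i` on the bonds of the
block and the PLAIN lattice gradients `‖A_i(x+e_μ)_ν − A_i(x)_ν‖ ≤ g_i` on the squares of the block (the quantifier
shapes of `RawSups₇.bond₀` ∕ `RawSups₇.gradU₀` VERBATIM with `U_i ↦ A_i`), letters `≥ 0`.  The printed TYPE of
B9 (3.35) («|A| < O(1)Mα₀(L^jη)^{-1}, |∇^ηA| < O(1)Mα₀(L^jη)^{-2} on □»; plain-vs-covariant gradient = cell question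
(u1)); NOT asserted for any configuration of the papers. -/
structure PotSups (L : ℕ) (z : Site d) (A₀ A₁ : Site d → Fin d → R) (p : PotLetters) : Prop where
  sup₀ : ∀ x ρ, InBlock L z x → InBlock L z (x + e ρ) → ‖A₀ x ρ‖ ≤ p.a₀
  sup₁ : ∀ x ρ, InBlock L z x → InBlock L z (x + e ρ) → ‖A₁ x ρ‖ ≤ p.a₁
  grad₀ : ∀ μ x ρ, InBlock L z x → InBlock L z (x + e ρ) → InBlock L z (x + e μ) →
    InBlock L z (x + e μ + e ρ) → ‖A₀ (x + e μ) ρ - A₀ x ρ‖ ≤ p.g₀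
  grad₁ : ∀ μ x ρ, InBlock L z x → InBlock L z (x + e ρ) → InBlock L z (x + e μ) →
    InBlock L z (x + e μ + e ρ) → ‖A₁ (x + e μ) ρ - A₁ x ρ‖ ≤ p.g₁
  nonneg : p.Nonneg

/-- [folklore] BOND DEVIATION FROM THE POTENTIAL: `U = e^{A}` on the block with `‖A‖ ≤ a` there (`0 ≤ a`) ⟹
`‖U⟨x,x+e_ρ⟩ − 1‖ ≤ a·e^{a}` on the block (`‖e^X − 1‖ ≤ ‖X‖e^{‖X‖}`, `B9Eq335Plaquette.norm_exp_sub_one_le_mul`). -/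
theorem bond_le_of_exp {U : Cfg d R} {A : Site d → Fin d → R} {a : ℝ} (he : IsExpOn L z U A)
    (ha : ∀ x ρ, InBlock L z x → InBlock L z (x + e ρ) → ‖A x ρ‖ ≤ a) (ha0 : 0 ≤ a) :
    ∀ x ρ, InBlock L z x → InBlock L z (x + e ρ) → ‖(U x ρ : R) - 1‖ ≤ a * Real.exp a := by
  intro x ρ h1 h2
  rw [he x ρ h1 h2, val_expUnit]
  have hX := ha x ρ h1 h2
  exact (B9Eq335Plaquette.norm_exp_sub_one_le_mul _).trans
    (mul_le_mul hX (Real.exp_le_exp.mpr hX) (Real.exp_pos _).le ha0)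

/-- [folklore] PLAIN BOND GRADIENT FROM THE POTENTIAL: `U = e^{A}` on the block with `‖A‖ ≤ a` and plain gradients
`≤ g` there ⟹ `‖U⟨x+e_μ,·⟩_ρ − U⟨x,·⟩_ρ‖ ≤ g·e^{a}` on the squares of the block (`‖e^X − e^Y‖ ≤ ‖X − Y‖e^{a}`,
`B9Eq335Plaquette.norm_exp_sub_exp_le_of_le`). -/
theorem grad_le_of_exp {U : Cfg d R} {A : Site d → Fin d → R} {a g : ℝ} (he : IsExpOn L z U A)
    (ha : ∀ x ρ, InBlock L z x → InBlock L z (x + e ρ) → ‖A x ρ‖ ≤ a)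
    (hg : ∀ μ x ρ, InBlock L z x → InBlock L z (x + e ρ) → InBlock L z (x + e μ) →
      InBlock L z (x + e μ + e ρ) → ‖A (x + e μ) ρ - A x ρ‖ ≤ g) :
    ∀ μ x ρ, InBlock L z x → InBlock L z (x + e ρ) → InBlock L z (x + e μ) →
      InBlock L z (x + e μ + e ρ) → ‖(U (x + e μ) ρ : R) - U x ρ‖ ≤ g * Real.exp a := by
  intro μ x ρ h1 h2 h3 h4
  rw [he (x + e μ) ρ h3 h4, he x ρ h1 h2, val_expUnit, val_expUnit]
  exact (B9Eq335Plaquette.norm_exp_sub_exp_le_of_le _ _ (ha _ _ h3 h4) (ha _ _ h1 h2)).trans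
    (mul_le_mul_of_nonneg_right (hg μ x ρ h1 h2 h3 h4) (Real.exp_pos _).le)

/-- [folklore] CURVATURE FROM THE POTENTIAL (b09's B9 (3.35) ⇒ B7 (52) plaquette step BY NAME): `U = e^{A}` on the
block with `‖A‖ ≤ a` and plain gradients `≤ g` there ⟹ `‖plaq U (y; ρ, ν) − 1‖ ≤ 2(g + a²)e^{4a}` on the squares of
the block — `plaq U (y; ρ, ν) = e^{A(y)_ρ} e^{A(y+e_ρ)_ν} e^{−A(y+e_ν)_ρ} e^{−A(y)_ν}` and
`B9Eq335Plaquette.norm_plaquette_exp_sub_one_le` with `‖X₁ − X₃‖ = ‖A(y)_ρ − A(y+e_ν)_ρ‖ ≤ g`,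
`‖X₂ − X₄‖ = ‖A(y+e_ρ)_ν − A(y)_ν‖ ≤ g`. -/
theorem curv_le_of_exp {U : Cfg d R} {A : Site d → Fin d → R} {a g : ℝ} (he : IsExpOn L z U A)
    (ha : ∀ x ρ, InBlock L z x → InBlock L z (x + e ρ) → ‖A x ρ‖ ≤ a)
    (hg : ∀ μ x ρ, InBlock L z x → InBlock L z (x + e ρ) → InBlock L z (x + e μ) →
      InBlock L z (x + e μ + e ρ) → ‖A (x + e μ) ρ - A x ρ‖ ≤ g) :
    PlaqSup L z (fun y ρ ν => ‖(plaq U y ρ ν : R) - 1‖) (2 * (g + a ^ 2) * Real.exp (4 * a)) := by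
  letI : NormedAlgebra ℚ R := NormedAlgebra.restrictScalars ℚ ℂ R
  intro y ρ ν _hρν h1 h2 h3 h4
  have h4' : InBlock L z (y + e ν + e ρ) := by rwa [add_right_comm]
  show ‖(plaq U y ρ ν : R) - 1‖ ≤ 2 * (g + a ^ 2) * Real.exp (4 * a)
  simp only [plaq, Units.val_mul]
  rw [he y ρ h1 h2, he (y + e ρ) ν h2 h4, he (y + e ν) ρ h3 h4', he y ν h1 h3]
  simp only [val_inv_expUnit, val_expUnit]
  refine B9Eq335Plaquette.norm_plaquette_exp_sub_one_le _ _ _ _ (ha _ _ h1 h2) (ha _ _ h2 h4) (ha _ _ h3 h4')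
    (ha _ _ h1 h3) ?_ ?_
  · rw [norm_sub_rev]
    exact hg ν y ρ h1 h2 h3 h4'
  · exact hg ρ y ν h1 h3 h2 h4

/-- **FOUR POTENTIAL SUPS GIVE THE SIX RAW SUPS** [folklore]: a unitary-like pair presented ON THE BLOCK as
exponentials of potentials with the four potential sups `p` has the six raw block sups `p.lift₆`
(`curv_le_of_exp`, `bond_le_of_exp`, `grad_le_of_exp`). -/
theorem RawSups₆.of_pot {U₀ U₁ : Cfg d R} {A₀ A₁ : Site d → Fin d → R} {p : PotLetters}
    (hu₀ : ∀ x ν, UnitaryLike (U₀ x ν)) (hu₁ : ∀ x ν, UnitaryLike (U₁ x ν)) (he₀ : IsExpOn L z U₀ A₀)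
    (he₁ : IsExpOn L z U₁ A₁) (h : PotSups L z A₀ A₁ p) : RawSups₆ L z U₀ U₁ p.lift₆ where
  unit₀ := hu₀
  unit₁ := hu₁
  curv₀ := curv_le_of_exp he₀ h.sup₀ h.grad₀
  curv₁ := curv_le_of_exp he₁ h.sup₁ h.grad₁
  bond₀ := bond_le_of_exp he₀ h.sup₀ h.nonneg.ha₀
  bond₁ := bond_le_of_exp he₁ h.sup₁ h.nonneg.ha₁
  gradU₀ := grad_le_of_exp he₀ h.sup₀ h.grad₀
  gradU₁ := grad_le_of_exp he₁ h.sup₁ h.grad₁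
  nonneg := h.nonneg.lift₆

/-- [folklore] (arith) THE POTENTIAL CONSTANT `potConst c = 2c(1+c)e^{4c}` (b09's `α₀′ = 2C(1+C)e^{4C}` of
`B9Eq335Plaquette.b7_52_of_b9_335`). -/
noncomputable def potConst (c : ℝ) : ℝ := 2 * c * (1 + c) * Real.exp (4 * c)

/-- [folklore] (arith) `0 ≤ potConst c` for `0 ≤ c`. -/
theorem potConst_nonneg {c : ℝ} (hc : 0 ≤ c) : 0 ≤ potConst c := by
  unfold potConst; positivity

/-- [folklore] (arith) `c·e^{c} ≤ potConst c` for `0 ≤ c`. -/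
theorem mul_exp_le_potConst {c : ℝ} (hc : 0 ≤ c) : c * Real.exp c ≤ potConst c := by
  unfold potConst
  have h1 : Real.exp c ≤ Real.exp (4 * c) := Real.exp_le_exp.mpr (by linarith)
  have h2 : c ≤ 2 * c * (1 + c) := by nlinarith
  exact mul_le_mul h2 h1 (Real.exp_pos _).le (by positivity)

/-- [folklore] (arith) `c ≤ potConst c` for `0 ≤ c`. -/
theorem le_potConst {c : ℝ} (hc : 0 ≤ c) : c ≤ potConst c := by
  have h1 : c ≤ c * Real.exp c := le_mul_of_one_le_right hc (Real.one_le_exp hc)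
  exact h1.trans (mul_exp_le_potConst hc)

/-- [folklore] (arith) `1 ≤ potConst c` for `1 ≤ c`. -/
theorem one_le_potConst {c : ℝ} (hc : 1 ≤ c) : 1 ≤ potConst c := hc.trans (le_potConst (by linarith))

/-- [folklore] (cell reading, NOT print) THE POTENTIAL DICTIONARY at `θ`: `C ≤ c`, `a₀, a₁ ≤ cθ`, `g₀, g₁ ≤ cθ²` — the
TYPE of (3.35) at the scale ratio `θ` (`|A| ≲ (L^jη)^{-1}`, `|∇A| ≲ (L^jη)^{-2}`).  NOT asserted for Bałaban's
configurations. -/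
structure DictP (θ c C : ℝ) (p : PotLetters) : Prop where
  count : C ≤ c
  sup₀ : p.a₀ ≤ c * θ
  grad₀ : p.g₀ ≤ c * θ ^ 2
  sup₁ : p.a₁ ≤ c * θ
  grad₁ : p.g₁ ≤ c * θ ^ 2

/-- [folklore] (cell reading, NOT print) THE POTENTIAL DICTIONARY WITH THE SMALL-FIELD PARAMETER `ε`: `C ≤ c`,
`a₀, a₁ ≤ ε·cθ`, `g₀, g₁ ≤ ε·cθ²`.  NOT asserted for Bałaban's configurations. -/
structure DictPE (θ ε c C : ℝ) (p : PotLetters) : Prop where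
  count : C ≤ c
  sup₀ : p.a₀ ≤ ε * (c * θ)
  grad₀ : p.g₀ ≤ ε * (c * θ ^ 2)
  sup₁ : p.a₁ ≤ ε * (c * θ)
  grad₁ : p.g₁ ≤ ε * (c * θ ^ 2)

/-- [folklore] At `ε = 1` the potential `ε`-dictionary is the potential dictionary. -/
theorem dictPE_one_iff {θ c C : ℝ} {p : PotLetters} : DictPE θ 1 c C p ↔ DictP θ c C p := by
  constructor
  · rintro ⟨h0, h1, h2, h3, h4⟩
    exact ⟨h0, by simpa using h1, by simpa using h2, by simpa using h3, by simpa using h4⟩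
  · rintro ⟨h0, h1, h2, h3, h4⟩
    exact ⟨h0, by simpa using h1, by simpa using h2, by simpa using h3, by simpa using h4⟩

/-- [folklore] (arith) THE CORE ARITHMETIC for one configuration: `0 < ε ≤ 1`, `0 < θ ≤ 1 ≤ c`, `0 ≤ a ≤ ε·cθ`,
`g ≤ ε·cθ²` ⟹ `2(g + a²)e^{4a} ≤ ε·potConst c·θ²`, `a·e^{a} ≤ ε·potConst c·θ`, `g·e^{a} ≤ ε·potConst c·θ²`. -/
theorem pot_arith {a g θ ε c : ℝ} (hε : 0 < ε) (hε1 : ε ≤ 1) (hθ : 0 < θ) (hθ1 : θ ≤ 1) (hc1 : 1 ≤ c)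
    (ha0 : 0 ≤ a) (ha : a ≤ ε * (c * θ)) (hg : g ≤ ε * (c * θ ^ 2)) :
    2 * (g + a ^ 2) * Real.exp (4 * a) ≤ ε * (potConst c * θ ^ 2) ∧
      a * Real.exp a ≤ ε * (potConst c * θ) ∧ g * Real.exp a ≤ ε * (potConst c * θ ^ 2) := by
  have hc0 : 0 ≤ c := by linarith
  have hε0 : 0 ≤ ε := hε.le
  have hθ0 : 0 ≤ θ := hθ.le
  have hεθ : ε * θ ≤ 1 := by nlinarith
  have hac : a ≤ c := by
    refine ha.trans ?_
    calc ε * (c * θ) = c * (ε * θ) := by ring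
      _ ≤ c * 1 := mul_le_mul_of_nonneg_left hεθ hc0
      _ = c := mul_one c
  have e1 : Real.exp a ≤ Real.exp c := Real.exp_le_exp.mpr hac
  have e4 : Real.exp (4 * a) ≤ Real.exp (4 * c) := Real.exp_le_exp.mpr (by linarith)
  have hcθ : 0 ≤ ε * (c * θ) := mul_nonneg hε0 (mul_nonneg hc0 hθ0)
  have hcθ2 : 0 ≤ ε * (c * θ ^ 2) := mul_nonneg hε0 (mul_nonneg hc0 (pow_nonneg hθ0 2))
  have hsq0 : 0 ≤ ε * (c * θ) ^ 2 := mul_nonneg hε0 (sq_nonneg _)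
  have ha2 : a ^ 2 ≤ ε * (c * θ) ^ 2 := by
    calc a ^ 2 ≤ (ε * (c * θ)) ^ 2 := pow_le_pow_left₀ ha0 ha 2
      _ = ε * (ε * (c * θ) ^ 2) := by ring
      _ ≤ ε * (c * θ) ^ 2 := mul_le_of_le_one_left hsq0 hε1
  have hK := mul_exp_le_potConst hc0
  refine ⟨?_, ?_, ?_⟩
  · calc 2 * (g + a ^ 2) * Real.exp (4 * a)
        ≤ 2 * (ε * (c * θ ^ 2) + ε * (c * θ) ^ 2) * Real.exp (4 * c) :=
          mul_le_mul (by linarith) e4 (Real.exp_pos _).le (by linarith)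
      _ = ε * (potConst c * θ ^ 2) := by unfold potConst; ring
  · calc a * Real.exp a ≤ ε * (c * θ) * Real.exp c := mul_le_mul ha e1 (Real.exp_pos _).le hcθ
      _ = ε * θ * (c * Real.exp c) := by ring
      _ ≤ ε * θ * potConst c := mul_le_mul_of_nonneg_left hK (mul_nonneg hε0 hθ0)
      _ = ε * (potConst c * θ) := by ring
  · calc g * Real.exp a ≤ ε * (c * θ ^ 2) * Real.exp c := by
          have hg0 : g * Real.exp a ≤ ε * (c * θ ^ 2) * Real.exp a :=
            mul_le_mul_of_nonneg_right hg (Real.exp_pos _).le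
          exact hg0.trans (mul_le_mul_of_nonneg_left e1 hcθ2)
      _ = ε * θ ^ 2 * (c * Real.exp c) := by ring
      _ ≤ ε * θ ^ 2 * potConst c := mul_le_mul_of_nonneg_left hK (mul_nonneg hε0 (pow_nonneg hθ0 2))
      _ = ε * (potConst c * θ ^ 2) := by ring

/-- **THE POTENTIAL `ε`-DICTIONARY GIVES THE SIX-LETTER ONE** [folklore] (arith) at the constant `potConst c`
(`0 < ε ≤ 1`, `0 < θ ≤ 1 ≤ c`, nonnegative potential letters): `pot_arith` twice. -/
theorem DictPE.lift {θ ε c C : ℝ} {p : PotLetters} (hε : 0 < ε) (hε1 : ε ≤ 1) (hθ : 0 < θ) (hθ1 : θ ≤ 1)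
    (hc1 : 1 ≤ c) (hn : p.Nonneg) (h : DictPE θ ε c C p) : Dict₆E θ ε (potConst c) C p.lift₆ := by
  obtain ⟨q0, t0, g0⟩ := pot_arith hε hε1 hθ hθ1 hc1 hn.ha₀ h.sup₀ h.grad₀
  obtain ⟨q1, t1, g1⟩ := pot_arith hε hε1 hθ hθ1 hc1 hn.ha₁ h.sup₁ h.grad₁
  exact ⟨h.count.trans (le_potConst (by linarith)), q0, q1, t0, t1, g0, g1⟩

/-- [folklore] (arith) At `ε = 1`: the potential dictionary gives the six-letter dictionary at `potConst c`. -/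
theorem DictP.lift {θ c C : ℝ} {p : PotLetters} (hθ : 0 < θ) (hθ1 : θ ≤ 1) (hc1 : 1 ≤ c) (hn : p.Nonneg)
    (h : DictP θ c C p) : Dict₆ θ (potConst c) C p.lift₆ :=
  dict₆E_one_iff.1 ((dictPE_one_iff.2 h).lift one_pos le_rfl hθ hθ1 hc1 hn)

/-- [folklore] THE PER-PAIR PRODUCER FROM FOUR POTENTIAL SUPS: a unitary-like pair presented on the block as
exponentials of potentials with potential sups obeying the potential `ε`-dictionary at `θ` (`0 < ε ≤ 1`,
`0 < θ ≤ 1 ≤ c`, `0 ≤ β ≤ 1`, `0 ≤ (d−1)(L−1)`, `L ≤ Λ`, `1 ≤ Λ`) ⟹ SOME window data `b_w` of the comb-gauge block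
deviation with `N_{(1,1,1)}(b_w) ≤ ε·sockConst (16·potConst c) Λ·θ²`. -/
theorem exists_windowData_unitPot_eps {U₀ U₁ : Cfg d R} {A₀ A₁ : Site d → Fin d → R} {β θ ε c Λ : ℝ}
    {p : PotLetters} (hε : 0 < ε) (hε1 : ε ≤ 1) (hθ : 0 < θ) (hθ1 : θ ≤ 1) (hβ0 : 0 ≤ β) (hβ1 : β ≤ 1)
    (hc1 : 1 ≤ c) (hΛ : 1 ≤ Λ) (hL : (L : ℝ) ≤ Λ) (hC0 : 0 ≤ ((d : ℝ) - 1) * ((L : ℝ) - 1))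
    (hu₀ : ∀ x ν, UnitaryLike (U₀ x ν)) (hu₁ : ∀ x ν, UnitaryLike (U₁ x ν)) (he₀ : IsExpOn L z U₀ A₀)
    (he₁ : IsExpOn L z U₁ A₁) (h : PotSups L z A₀ A₁ p)
    (hD : DictPE θ ε c (((d : ℝ) - 1) * ((L : ℝ) - 1)) p) :
    ∃ bw : Win, WindowData L z β (blockDev L z (combGauge U₀ U₁ z) U₀ U₁) bw ∧
      winN unitWin bw ≤ ε * sockConst (16 * potConst c) Λ * θ ^ 2 :=
  exists_windowData_unit₆_eps hε hε1 hθ hθ1 hβ0 hβ1 (one_le_potConst hc1) hΛ hL hC0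
    (RawSups₆.of_pot hu₀ hu₁ he₀ he₁ h) (hD.lift hε hε1 hθ hθ1 hc1 h.nonneg)

end Pot

section PotSocket

variable [NormOneClass R] [NormedAlgebra ℂ R] [CompleteSpace R] {F : Type*} [NormedAddCommGroup F]
  [NormedSpace ℂ F] [CompleteSpace F]
variable {B : Booking} {T : Trajectory B}

/-- **THE POTENTIAL FEED ⟹ `TransportsFrom`** [folklore] (= `transportsFrom_of_combRaw₆_eps` at the constant
`potConst c`, the feed mapped through `RawSups₆.of_pot` ∕ `DictPE.lift`; weights `(1,1,1)`,
`c_δ = ε·sockConst (16·potConst c) Λ`, `ψ = ϑ²`).  THE FEED, per consumer block of history depth `k − k′` below a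
passed gate and per `ε′ > 0`: a unitary-like attaining pair `(U₀, U₁)` with `val U₀ ∈ 𝒦 b k′`, presented ON THE
BLOCK as exponentials of potentials `A₀, A₁` (`IsExpOn`) whose FOUR potential sups (`PotSups`: block sups and plain
lattice gradients) obey the (3.35)-TYPE dictionary `DictPE (ϑ^{k−k′}) ε c ((d−1)(Lg b k′−1))` — `‖A_i‖ ≤ ε·cθ`,
`‖∇A_i‖ ≤ ε·cθ²`, `θ = ϑ^{k−k′}`; window hypothesis `ε·sockConst (16·potConst c) Λ ≤ w`.  NOT asserted for the
cell's terms: every input is a binder ((W2) of GAPS G-pv24g16-1 restated in the currency of potentials, NOT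
discharged). -/
theorem transportsFrom_of_combPot_eps {Gate : ℕ → Prop} {Fn : B.Birth → ℕ → Fld d R → F}
    {Lg : B.Birth → ℕ → ℕ} {zg : B.Birth → ℕ → Site d} {𝒦 : B.Birth → ℕ → Set (Fld d R)}
    {β : ℝ} {w r ε c Λ ϑ : ℝ}
    (hinv : ∀ b k', GaugeInvariant (BlockRel (Lg b k') (zg b k')) (Fn b k'))
    (hsl : ∀ b k', BirthSlice (Fn b k') (wMove (Lg b k') (zg b k') β) (wN (Lg b k') (zg b k') β unitWin) (𝒦 b k')
      w r (T.gen b k'))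
    (hr : 0 < r) (hε : 0 < ε) (hε1 : ε ≤ 1) (hβ0 : 0 ≤ β) (hβ1 : β ≤ 1) (hc1 : 1 ≤ c) (hΛ : 1 ≤ Λ) (hϑ : 0 < ϑ)
    (hϑ1 : ϑ ≤ 1) (hw : ε * sockConst (16 * potConst c) Λ ≤ w) (hL : ∀ b k', (Lg b k' : ℝ) ≤ Λ)
    (hCnn : ∀ b k', 0 ≤ ((d : ℝ) - 1) * ((Lg b k' : ℝ) - 1))
    (hCc : ∀ b k', ((d : ℝ) - 1) * ((Lg b k' : ℝ) - 1) ≤ c)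
    (hfeed : ∀ (b : B.Birth) (k' k : ℕ), B.birthScale b ≤ k' → k' ≤ k → k ≤ B.K → RanBelow Gate k → ∀ ε' > 0,
      ∃ U₀ U₁ : Cfg d R, ∃ A₀ A₁ : Site d → Fin d → R, ∃ p : PotLetters, val U₀ ∈ 𝒦 b k' ∧
        (∀ x ν, UnitaryLike (U₀ x ν)) ∧ (∀ x ν, UnitaryLike (U₁ x ν)) ∧
        IsExpOn (Lg b k') (zg b k') U₀ A₀ ∧ IsExpOn (Lg b k') (zg b k') U₁ A₁ ∧
        PotSups (Lg b k') (zg b k') A₀ A₁ p ∧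
        DictPE (ϑ ^ (k - k')) ε c (((d : ℝ) - 1) * ((Lg b k' : ℝ) - 1)) p ∧
        T.lin b k' k ≤ ‖Fn b k' (val U₁) - Fn b k' (val U₀)‖ + ε') :
    T.TransportsFrom (4 * (ε * sockConst (16 * potConst c) Λ) / r) (ϑ ^ 2) Gate := by
  have hc0 : (0 : ℝ) ≤ c := by linarith
  refine transportsFrom_of_combRaw₆_eps hinv hsl hr hε hε1 hβ0 hβ1 (one_le_potConst hc1) hΛ hϑ hϑ1 hw hL hCnn
    (fun b k' => (hCc b k').trans (le_potConst hc0)) ?_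
  intro b k' k hbk' hk'k hk hran ε' hε'
  obtain ⟨U₀, U₁, A₀, A₁, p, hK, hu₀, hu₁, he₀, he₁, hP, hD, hle⟩ := hfeed b k' k hbk' hk'k hk hran ε' hε'
  exact ⟨U₀, U₁, p.lift₆, hK, RawSups₆.of_pot hu₀ hu₁ he₀ he₁ hP,
    hD.lift hε hε1 (pow_pos hϑ _) (pow_le_one₀ hϑ.le hϑ1) hc1 hP.nonneg, hle⟩

/-- **END TO END WITH THE POTENTIAL `ε`-FEED (strict product, bounded weights — K-UNIFORM)** [folklore]
(= `T4CombWindowSocket.latticeTrajectory_budget_combRaw₇_eps_strict` with the potential feed: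
`transportsFrom_of_combPot_eps` under the history of the returned gate `(TOB-k) ∧ H`, then
`T4TrajectoryComparison.Trajectory.sizeBound_cubeBudget_of_trajectory_strict` BY NAME; any
`C ≥ 4·(ε·sockConst (16·potConst c) Λ)/r`).  NOT asserted for the cell's terms. -/
theorem latticeTrajectory_budget_combPot_eps_strict {Fn : B.Birth → ℕ → Fld d R → F}
    {Lg : B.Birth → ℕ → ℕ} {zg : B.Birth → ℕ → Site d} {𝒦 : B.Birth → ℕ → Set (Fld d R)}
    {β : ℝ} {w r ε c Λ ϑ : ℝ} {N : ℕ → ℕ → ℝ} {wt : ℕ → ℝ} {N₀ Λc wbar C cR Ahat τ r' : ℝ} {H : ℕ → Prop}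
    (hinv : ∀ b k', GaugeInvariant (BlockRel (Lg b k') (zg b k')) (Fn b k'))
    (hsl : ∀ b k', BirthSlice (Fn b k') (wMove (Lg b k') (zg b k') β) (wN (Lg b k') (zg b k') β unitWin) (𝒦 b k')
      w r (T.gen b k'))
    (hr : 0 < r) (hε : 0 < ε) (hε1 : ε ≤ 1) (hβ0 : 0 ≤ β) (hβ1 : β ≤ 1) (hc1 : 1 ≤ c) (hΛ : 1 ≤ Λ) (hϑ : 0 < ϑ)
    (hϑ1 : ϑ ≤ 1) (hww : ε * sockConst (16 * potConst c) Λ ≤ w) (hL : ∀ b k', (Lg b k' : ℝ) ≤ Λ)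
    (hCnn : ∀ b k', 0 ≤ ((d : ℝ) - 1) * ((Lg b k' : ℝ) - 1))
    (hCc : ∀ b k', ((d : ℝ) - 1) * ((Lg b k' : ℝ) - 1) ≤ c)
    (hCle : 4 * (ε * sockConst (16 * potConst c) Λ) / r ≤ C)
    (hfeed : ∀ (b : B.Birth) (k' k : ℕ), B.birthScale b ≤ k' → k' ≤ k → k ≤ B.K →
      RanBelow (fun i => CubeBudgetAt B wt ((N₀ * (C * Ahat)) * wbar * (1 - r')⁻¹) i ∧ H i) k → ∀ ε' > 0,
      ∃ U₀ U₁ : Cfg d R, ∃ A₀ A₁ : Site d → Fin d → R, ∃ p : PotLetters, val U₀ ∈ 𝒦 b k' ∧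
        (∀ x ν, UnitaryLike (U₀ x ν)) ∧ (∀ x ν, UnitaryLike (U₁ x ν)) ∧
        IsExpOn (Lg b k') (zg b k') U₀ A₀ ∧ IsExpOn (Lg b k') (zg b k') U₁ A₁ ∧
        PotSups (Lg b k') (zg b k') A₀ A₁ p ∧
        DictPE (ϑ ^ (k - k')) ε c (((d : ℝ) - 1) * ((Lg b k' : ℝ) - 1)) p ∧
        T.lin b k' k ≤ ‖Fn b k' (val U₁) - Fn b k' (val U₀)‖ + ε')
    (hw : ∀ j, j ≤ B.K → 0 ≤ wt j) (hwb : ∀ j, j ≤ B.K → wt j ≤ wbar) (hN : B.PositionalCount N)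
    (hNle : ∀ j k, j ≤ k → k ≤ B.K → N j k ≤ N₀ * Λc ^ (k - j)) (hN₀ : 0 ≤ N₀) (hΛc : 0 ≤ Λc)
    (hcR : 0 ≤ cR) (hAhat : 0 ≤ Ahat) (hτ0 : 0 ≤ τ) (hτ1 : τ ≤ 1)
    (hprod : Λc * (ϑ ^ 2 + C * cR) * τ ≤ r') (hr'1 : r' < 1) (h0 : T.BirthGen Ahat τ)
    (hreg : T.RegeneratesFrom cR (fun k => CubeBudgetAt B wt ((N₀ * (C * Ahat)) * wbar * (1 - r')⁻¹) k ∧ H k))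
    (hH : GateOfSizes B (twoRate B.K (C * Ahat) (ϑ ^ 2 + C * cR) τ) H) :
    B.SizeBound (twoRate B.K (C * Ahat) (ϑ ^ 2 + C * cR) τ) ∧
      B.CubeBudget wt ((N₀ * (C * Ahat)) * wbar * (1 - r')⁻¹) ∧ ∀ k, k ≤ B.K → H k := by
  have hΛ0 : 0 ≤ Λ := zero_le_one.trans hΛ
  have hψ : (0 : ℝ) ≤ ϑ ^ 2 := pow_nonneg hϑ.le 2
  have hK0 : (1 : ℝ) ≤ 16 * potConst c := by have := one_le_potConst hc1; linarith
  have hC0 : 0 ≤ 4 * (ε * sockConst (16 * potConst c) Λ) / r :=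
    div_nonneg (mul_nonneg (by norm_num) (mul_nonneg hε.le (sockConst_nonneg (zero_le_one.trans hK0) hΛ0))) hr.le
  have hCC : 0 ≤ C := hC0.trans hCle
  have htr := (transportsFrom_of_combPot_eps hinv hsl hr hε hε1 hβ0 hβ1 hc1 hΛ hϑ hϑ1 hww hL hCnn hCc
    hfeed).mono hCle hψ le_rfl hCC
  exact Trajectory.sizeBound_cubeBudget_of_trajectory_strict hw hwb hN hNle hN₀ hΛc hCC hψ hcR hAhat hτ0 hτ1 hprod
    hr'1 h0 htr hreg hH

end PotSocket

/-! ## §3  [folklore] Non-vacuity of the potential feed -/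

section Witness

variable [NormOneClass R] [NormedAlgebra ℂ R] [CompleteSpace R] {L : ℕ} {z : Site d}

/-- [folklore] The zero potential letters. -/
def PotLetters.zero : PotLetters := ⟨0, 0, 0, 0⟩

/-- [folklore] The zero potential letters are nonnegative. -/
theorem PotLetters.zero_nonneg : PotLetters.zero.Nonneg := ⟨le_rfl, le_rfl, le_rfl, le_rfl⟩

/-- [folklore] The zero potential letters obey the `ε`-dictionary for any `0 ≤ ε`, `0 ≤ θ`, `0 ≤ c`, `C ≤ c`. -/
theorem dictPE_zero {θ ε c C : ℝ} (hε : 0 ≤ ε) (hθ : 0 ≤ θ) (hc : 0 ≤ c) (hC : C ≤ c) :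
    DictPE θ ε c C PotLetters.zero :=
  ⟨hC, by show (0 : ℝ) ≤ _; positivity, by show (0 : ℝ) ≤ _; positivity, by show (0 : ℝ) ≤ _; positivity,
    by show (0 : ℝ) ≤ _; positivity⟩

omit [NormOneClass R] [NormedAlgebra ℂ R] [CompleteSpace R] in
/-- [folklore] The zero potentials have all four potential sups `0`. -/
theorem potSups_zero (L : ℕ) (z : Site d) :
    PotSups (R := R) L z (fun _ _ => 0) (fun _ _ => 0) PotLetters.zero :=
  ⟨fun _ _ _ _ => by simp [PotLetters.zero], fun _ _ _ _ => by simp [PotLetters.zero],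
    fun _ _ _ _ _ _ _ => by simp [PotLetters.zero], fun _ _ _ _ _ _ _ => by simp [PotLetters.zero],
    PotLetters.zero_nonneg⟩

omit [NormOneClass R] in
/-- [folklore] The configuration `U ≡ e^{0}` is presented by the zero potential on every block. -/
theorem isExpOn_zero (L : ℕ) (z : Site d) :
    IsExpOn (R := R) L z (fun _ _ => expUnit 0) (fun _ _ => 0) := fun _ _ _ _ => rfl

/-- [folklore] `e^{0}` is unitary-like (`‖e^0‖ = ‖1‖ = 1`). -/
theorem unitaryLike_expUnit_zero : UnitaryLike (expUnit (0 : R)) := by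
  letI : NormedAlgebra ℚ R := NormedAlgebra.restrictScalars ℚ ℂ R
  refine ⟨?_, ?_⟩
  · show ‖((expUnit (0 : R) : Rˣ) : R)‖ ≤ 1
    rw [val_expUnit, exp_zero, norm_one]
  · show ‖(((expUnit (0 : R))⁻¹ : Rˣ) : R)‖ ≤ 1
    rw [val_inv_expUnit, val_expUnit, neg_zero, exp_zero, norm_one]

/-- [folklore] NON-VACUITY OF THE POTENTIAL FEED's per-pair content: the pair `U₀ = U₁ ≡ e^{0}` with zero potentials
has window data of its comb-gauge deviation inside the unit-weight window at the rate
`ε·sockConst (16·potConst c) Λ·θ²` for every `0 < ε ≤ 1`, `0 < θ ≤ 1 ≤ c`, `0 ≤ β ≤ 1`, `L ≤ Λ`, `1 ≤ Λ`,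
`0 ≤ (d−1)(L−1) ≤ c` — the hypotheses of `exists_windowData_unitPot_eps` are jointly satisfiable. -/
example (L : ℕ) (z : Site d) {β θ ε c Λ : ℝ} (hε : 0 < ε) (hε1 : ε ≤ 1) (hθ : 0 < θ) (hθ1 : θ ≤ 1)
    (hβ0 : 0 ≤ β) (hβ1 : β ≤ 1) (hc1 : 1 ≤ c) (hΛ : 1 ≤ Λ) (hL : (L : ℝ) ≤ Λ)
    (hC0 : 0 ≤ ((d : ℝ) - 1) * ((L : ℝ) - 1)) (hC : ((d : ℝ) - 1) * ((L : ℝ) - 1) ≤ c) :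
    ∃ bw : Win, WindowData L z β (blockDev L z (combGauge (fun _ _ => expUnit (0 : R)) (fun _ _ => expUnit 0) z)
      (fun _ _ => expUnit (0 : R)) (fun _ _ => expUnit 0)) bw ∧
      winN unitWin bw ≤ ε * sockConst (16 * potConst c) Λ * θ ^ 2 :=
  exists_windowData_unitPot_eps hε hε1 hθ hθ1 hβ0 hβ1 hc1 hΛ hL hC0 (fun _ _ => unitaryLike_expUnit_zero)
    (fun _ _ => unitaryLike_expUnit_zero) (isExpOn_zero L z) (isExpOn_zero L z) (potSups_zero L z)
    (dictPE_zero hε.le hθ.le (zero_le_one.trans hc1) hC)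

/-- [folklore] THE POTENTIAL FEED IMPLIES THE SIX-LETTER FEED's per-pair content, which implies the SEVEN-LETTER one
(`RawSups₆.of_pot` ∕ `DictPE.lift`, then `RawSups₆.lift` ∕ `Dict₆E.lift`): the chain of sockets
potential ⟹ six letters ⟹ seven letters ⟹ (§6 of `T4CombWindowSocket`) twelve letters ⟹ window. -/
example {U₀ U₁ : Cfg d R} {A₀ A₁ : Site d → Fin d → R} {θ ε c C : ℝ} {p : PotLetters} (hε : 0 < ε)
    (hε1 : ε ≤ 1) (hθ : 0 < θ) (hθ1 : θ ≤ 1) (hc1 : 1 ≤ c) (hu₀ : ∀ x ν, UnitaryLike (U₀ x ν))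
    (hu₁ : ∀ x ν, UnitaryLike (U₁ x ν)) (he₀ : IsExpOn L z U₀ A₀) (he₁ : IsExpOn L z U₁ A₁)
    (h : PotSups L z A₀ A₁ p) (hD : DictPE θ ε c C p) :
    RawSups₇ L z U₀ U₁ p.lift₆.lift₇ ∧ Dict₇E θ ε (2 * potConst c) C p.lift₆.lift₇ :=
  ⟨(RawSups₆.of_pot hu₀ hu₁ he₀ he₁ h).lift,
    (hD.lift hε hε1 hθ hθ1 hc1 h.nonneg).lift hε.le hθ.le (potConst_nonneg (by linarith))⟩

end Witness

/-! ## §4  [folklore] THE RELATIVE (PRODUCT) PRESENTATION `U₁ = e^{A}·U₀` — the lettering of B8 (1.36) ∕ (1.40) -/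

section Rel

open T4DirectionChart (transport basePlaq movedPlaq)

/-- [folklore] `‖P·V − 1‖ ≤ ‖P − 1‖ + ‖V − 1‖` for a unitary-like unit `V` (`T4AxialChain.norm_mul_sub_one_le_add'`). -/
theorem norm_mul_unitaryLike_sub_one_le (P : R) {V : Rˣ} (hV : UnitaryLike V) :
    ‖P * (V : R) - 1‖ ≤ ‖P - 1‖ + ‖(V : R) - 1‖ :=
  T4AxialChain.norm_mul_sub_one_le_add' P hV.1

variable [NormOneClass R] [NormedAlgebra ℂ R] [CompleteSpace R]

/-- [folklore] HYPOTHESIS SHAPE — THE RELATIVE (PRODUCT) PRESENTATION ON THE BLOCK: every bond variable of the block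
`B(z)` of the SECOND configuration is the exponential of the relative potential times the background's bond variable,
`U₁⟨x, x+e_ν⟩ = e^{A(x)_ν}·U₀⟨x, x+e_ν⟩` (b07's unit `B7Prop1Explicit.expUnit`).  The shape of B8 (1.40)–(1.41)'s
«U₁ = e^{iηA}» for the pair `(U₀, U₁U₀)`, in the tree's lettering (`U₁` = the FULL second configuration = print's
`U₁U₀`); the gauge is the feed provider's business.  NOT asserted for any configuration of the papers. -/
def IsExpRelOn (L : ℕ) (z : Site d) (U₀ U₁ : Cfg d R) (A : Site d → Fin d → R) : Prop :=
  ∀ x ν, InBlock L z x → InBlock L z (x + e ν) → U₁ x ν = expUnit (A x ν) * U₀ x ν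

/-- [folklore] THE FIVE RELATIVE LETTERS: the background's three raw block sups `q₀` (plaquette deviation), `τ₀` (bond
deviation), `γU₀` (plain bond gradient), and the relative potential's block sup `a` and lattice-gradient sup `g`. -/
structure RelLetters where
  /-- block sup of `‖plaq U₀ − 1‖` -/
  q₀ : ℝ
  /-- block sup of `‖U₀(b) − 1‖` -/
  τ₀ : ℝ
  /-- block sup of the plain bond gradient of `U₀` -/
  γU₀ : ℝ
  /-- block sup of `‖A‖` -/
  a : ℝ
  /-- block sup of the (plain or covariant) lattice gradient of `A` -/
  g : ℝ

/-- [folklore] All five relative letters nonnegative. -/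
structure RelLetters.Nonneg (r : RelLetters) : Prop where
  hq₀ : 0 ≤ r.q₀
  hτ₀ : 0 ≤ r.τ₀
  hγU₀ : 0 ≤ r.γU₀
  ha : 0 ≤ r.a
  hg : 0 ≤ r.g

/-- [folklore] THE DERIVED SIX LETTERS of five relative letters: `q₀`, `q₁ := q₀ + 2((g + 2a(q₀ + τ₀)) + a²)e^{4a}`
(`relCurv_le`), `τ₀`, `τ₁ := a e^{a} + τ₀` (`relBond_le`), `γU₀`, `γU₁ := g e^{a} + e^{a}γU₀` (`relGrad_le`). -/
noncomputable def RelLetters.lift₆ (r : RelLetters) : Letters₆ :=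
  ⟨r.q₀, r.q₀ + 2 * ((r.g + 2 * r.a * (r.q₀ + r.τ₀)) + r.a ^ 2) * Real.exp (4 * r.a), r.τ₀,
    r.a * Real.exp r.a + r.τ₀, r.γU₀, r.g * Real.exp r.a + Real.exp r.a * r.γU₀⟩

/-- [folklore] The derived six letters of nonnegative relative letters are nonnegative. -/
theorem RelLetters.Nonneg.lift₆ {r : RelLetters} (h : r.Nonneg) : r.lift₆.Nonneg := by
  obtain ⟨hq₀, hτ₀, hγU₀, ha, hg⟩ := h
  refine ⟨hq₀, ?_, hτ₀, ?_, hγU₀, ?_⟩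
  · show 0 ≤ r.q₀ + 2 * ((r.g + 2 * r.a * (r.q₀ + r.τ₀)) + r.a ^ 2) * Real.exp (4 * r.a)
    positivity
  · show 0 ≤ r.a * Real.exp r.a + r.τ₀
    positivity
  · show 0 ≤ r.g * Real.exp r.a + Real.exp r.a * r.γU₀
    positivity

variable {L : ℕ} {z : Site d}

/-- [folklore] THE FIVE RAW RELATIVE SUPS on the block `B(z)` of side `L`: the background's `curv₀`, `bond₀`, `gradU₀`
(the `U₀`-fields of `RawSups₆` VERBATIM) and the relative potential's block sup `‖A(x)_ν‖ ≤ a` and PLAIN lattice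
gradient `‖A(x+e_μ)_ν − A(x)_ν‖ ≤ g` (the quantifier shapes of `PotSups.sup₀` ∕ `PotSups.grad₀` VERBATIM), letters
`≥ 0`.  The printed TYPE of B8 (1.7) ∕ B9 (3.35) for the background and of B8 (1.41) ∕ (1.36) for the relative
potential (its COVARIANT gradient: `RelSupsCov` below).  NOT asserted for any configuration of the papers. -/
structure RelSups (L : ℕ) (z : Site d) (U₀ : Cfg d R) (A : Site d → Fin d → R) (r : RelLetters) : Prop where
  curv₀ : PlaqSup L z (fun y ρ ν => ‖(plaq U₀ y ρ ν : R) - 1‖) r.q₀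
  bond₀ : ∀ x ρ, InBlock L z x → InBlock L z (x + e ρ) → ‖(U₀ x ρ : R) - 1‖ ≤ r.τ₀
  gradU₀ : ∀ μ x ρ, InBlock L z x → InBlock L z (x + e ρ) → InBlock L z (x + e μ) →
    InBlock L z (x + e μ + e ρ) → ‖(U₀ (x + e μ) ρ : R) - U₀ x ρ‖ ≤ r.γU₀
  supA : ∀ x ρ, InBlock L z x → InBlock L z (x + e ρ) → ‖A x ρ‖ ≤ r.a
  gradA : ∀ μ x ρ, InBlock L z x → InBlock L z (x + e ρ) → InBlock L z (x + e μ) →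
    InBlock L z (x + e μ + e ρ) → ‖A (x + e μ) ρ - A x ρ‖ ≤ r.g
  nonneg : r.Nonneg

omit [NormOneClass R] in
/-- [folklore] THE PLAQUETTE WORD OF THE PRODUCT PRESENTATION is the tree's MOVED PLAQUETTE at parameter `1`:
`(e^{A₁}V₁)(e^{A₂}V₂)(e^{A₃}V₃)⁻¹(e^{A₄}V₄)⁻¹ = T4DirectionChart.movedPlaq 1 V₁ V₂ V₃ V₄ A₁ A₂ A₃ A₄`. -/
theorem val_relPlaqWord_eq_movedPlaq (V₁ V₂ V₃ V₄ : Rˣ) (A₁ A₂ A₃ A₄ : R) :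
    (((expUnit A₁ * V₁) * (expUnit A₂ * V₂) * (expUnit A₃ * V₃)⁻¹ * (expUnit A₄ * V₄)⁻¹ : Rˣ) : R) =
      movedPlaq 1 V₁ V₂ V₃ V₄ A₁ A₂ A₃ A₄ := by
  simp only [movedPlaq, one_smul, Units.val_mul, mul_inv_rev, val_expUnit, val_inv_expUnit, mul_assoc]

/-- [folklore] RELATIVE BOND DEVIATION: `U₁ = e^{A}U₀` on the block, `‖A‖ ≤ a` (`0 ≤ a`), `‖U₀(b) − 1‖ ≤ τ₀`, `U₀`
unitary-like ⟹ `‖U₁(b) − 1‖ ≤ a e^{a} + τ₀` on the block (`‖e^{A}U₀ − 1‖ ≤ ‖e^{A} − 1‖ + ‖U₀ − 1‖`,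
`B9Eq335Plaquette.norm_exp_sub_one_le_mul`; record D3 §2 row 5's «DERIVED» in kernel). -/
theorem relBond_le {U₀ U₁ : Cfg d R} {A : Site d → Fin d → R} {a τ₀ : ℝ} (hu₀ : ∀ x ν, UnitaryLike (U₀ x ν))
    (he : IsExpRelOn L z U₀ U₁ A) (ha : ∀ x ρ, InBlock L z x → InBlock L z (x + e ρ) → ‖A x ρ‖ ≤ a) (ha0 : 0 ≤ a)
    (hτ : ∀ x ρ, InBlock L z x → InBlock L z (x + e ρ) → ‖(U₀ x ρ : R) - 1‖ ≤ τ₀) :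
    ∀ x ρ, InBlock L z x → InBlock L z (x + e ρ) → ‖(U₁ x ρ : R) - 1‖ ≤ a * Real.exp a + τ₀ := by
  intro x ρ h1 h2
  rw [he x ρ h1 h2, Units.val_mul, val_expUnit]
  have hX := ha x ρ h1 h2
  refine (norm_mul_unitaryLike_sub_one_le _ (hu₀ x ρ)).trans (add_le_add ?_ (hτ x ρ h1 h2))
  exact (B9Eq335Plaquette.norm_exp_sub_one_le_mul _).trans
    (mul_le_mul hX (Real.exp_le_exp.mpr hX) (Real.exp_pos _).le ha0)

/-- [folklore] RELATIVE PLAIN BOND GRADIENT (the product rule): `U₁ = e^{A}U₀` on the block, `‖A‖ ≤ a`, plain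
gradients of `A` `≤ g`, plain bond gradients of `U₀` `≤ γU₀`, `U₀` unitary-like ⟹
`‖U₁⟨x+e_μ,·⟩_ρ − U₁⟨x,·⟩_ρ‖ ≤ g e^{a} + e^{a}γU₀` — `e^{A′}V′ − e^{A}V = (e^{A′} − e^{A})V′ + e^{A}(V′ − V)`,
`B9Eq335Plaquette.norm_exp_sub_exp_le_of_le` ∕ `norm_exp_le_of_le`; record D3 §2 row 7's «DERIVED» in kernel. -/
theorem relGrad_le {U₀ U₁ : Cfg d R} {A : Site d → Fin d → R} {a g γU₀ : ℝ} (hu₀ : ∀ x ν, UnitaryLike (U₀ x ν))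
    (he : IsExpRelOn L z U₀ U₁ A) (ha : ∀ x ρ, InBlock L z x → InBlock L z (x + e ρ) → ‖A x ρ‖ ≤ a)
    (hg : ∀ μ x ρ, InBlock L z x → InBlock L z (x + e ρ) → InBlock L z (x + e μ) →
      InBlock L z (x + e μ + e ρ) → ‖A (x + e μ) ρ - A x ρ‖ ≤ g)
    (hγ : ∀ μ x ρ, InBlock L z x → InBlock L z (x + e ρ) → InBlock L z (x + e μ) →
      InBlock L z (x + e μ + e ρ) → ‖(U₀ (x + e μ) ρ : R) - U₀ x ρ‖ ≤ γU₀) :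
    ∀ μ x ρ, InBlock L z x → InBlock L z (x + e ρ) → InBlock L z (x + e μ) →
      InBlock L z (x + e μ + e ρ) → ‖(U₁ (x + e μ) ρ : R) - U₁ x ρ‖ ≤ g * Real.exp a + Real.exp a * γU₀ := by
  intro μ x ρ h1 h2 h3 h4
  rw [he (x + e μ) ρ h3 h4, he x ρ h1 h2, Units.val_mul, Units.val_mul, val_expUnit, val_expUnit]
  have hsplit : exp (A (x + e μ) ρ) * (U₀ (x + e μ) ρ : R) - exp (A x ρ) * (U₀ x ρ : R) =
      (exp (A (x + e μ) ρ) - exp (A x ρ)) * (U₀ (x + e μ) ρ : R) +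
        exp (A x ρ) * ((U₀ (x + e μ) ρ : R) - U₀ x ρ) := by
    noncomm_ring
  rw [hsplit]
  refine (norm_add_le _ _).trans (add_le_add ?_ ?_)
  · exact (norm_mul_unit_le (hu₀ _ _) _).trans
      ((B9Eq335Plaquette.norm_exp_sub_exp_le_of_le _ _ (ha _ _ h3 h4) (ha _ _ h1 h2)).trans
        (mul_le_mul_of_nonneg_right (hg μ x ρ h1 h2 h3 h4) (Real.exp_pos _).le))
  · exact (norm_mul_le _ _).trans (mul_le_mul (B9Eq335Plaquette.norm_exp_le_of_le _ (ha _ _ h1 h2))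
      (hγ μ x ρ h1 h2 h3 h4) (norm_nonneg _) (Real.exp_pos _).le)

/-- **THE RELATIVE PLAQUETTE LEMMA** [folklore] (one square; the tree's COVARIANT TRANSPORT IDENTITY + b09's plaquette
step, both BY NAME): unitary-like bond variables `V₁, …, V₄` around a square with base plaquette deviation
`‖V₁V₂V₃⁻¹V₄⁻¹ − 1‖ ≤ q` and `‖V₁ − 1‖, ‖V₄ − 1‖ ≤ τ`, potentials `‖A_i‖ ≤ a` with `‖A₁ − A₃‖, ‖A₂ − A₄‖ ≤ g` ⟹
`‖(e^{A₁}V₁)(e^{A₂}V₂)(e^{A₃}V₃)⁻¹(e^{A₄}V₄)⁻¹ − 1‖ ≤ q + 2((g + 2a(q + τ)) + a²)e^{4a}`.  Proof: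
`movedPlaq = e^{Ã₁}e^{Ã₂}e^{−Ã₃}e^{−Ã₄}·P₀` with `Ã₁ = A₁`, `Ã₂ = V₁A₂V₁⁻¹`, `Ã₃ = W A₃W⁻¹` (`W = V₁V₂V₃⁻¹ = P₀V₄`),
`Ã₄ = P₀A₄P₀⁻¹` (`T4DirectionChart.movedPlaq_eq` ∕ `norm_movedPlaq_sub_one_le`); transports by unitary-likes do not
increase norms and move an element by `≤ 2‖u − 1‖·‖X‖` (`GUnit.norm_transport_le` ∕ `norm_transport_sub_self_le`,
`‖W − 1‖ ≤ q + τ`), so `‖Ã_i‖ ≤ a` and `‖Ã₁ − Ã₃‖, ‖Ã₂ − Ã₄‖ ≤ g + 2a(q + τ)`; then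
`B9Eq335Plaquette.norm_plaquette_exp_sub_one_le`. -/
theorem norm_relPlaq_sub_one_le {V₁ V₂ V₃ V₄ : Rˣ} (g₁ : UnitaryLike V₁) (g₂ : UnitaryLike V₂)
    (g₃ : UnitaryLike V₃) (g₄ : UnitaryLike V₄) (A₁ A₂ A₃ A₄ : R) {a g q τ : ℝ} (n₁ : ‖A₁‖ ≤ a) (n₂ : ‖A₂‖ ≤ a)
    (n₃ : ‖A₃‖ ≤ a) (n₄ : ‖A₄‖ ≤ a) (hq : ‖((basePlaq V₁ V₂ V₃ V₄ : Rˣ) : R) - 1‖ ≤ q)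
    (hτ₁ : ‖(V₁ : R) - 1‖ ≤ τ) (hτ₄ : ‖(V₄ : R) - 1‖ ≤ τ) (d₁₃ : ‖A₁ - A₃‖ ≤ g) (d₂₄ : ‖A₂ - A₄‖ ≤ g) :
    ‖movedPlaq 1 V₁ V₂ V₃ V₄ A₁ A₂ A₃ A₄ - 1‖ ≤ q + 2 * ((g + 2 * a * (q + τ)) + a ^ 2) * Real.exp (4 * a) := by
  letI : NormedAlgebra ℚ R := NormedAlgebra.restrictScalars ℚ ℂ R
  have gP : UnitaryLike (basePlaq V₁ V₂ V₃ V₄) := g₁.basePlaq g₂ g₃ g₄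
  have gW : UnitaryLike (V₁ * V₂ * V₃⁻¹) := g₁.path₃ g₂ g₃
  have ha0 : 0 ≤ a := (norm_nonneg _).trans n₁
  have hq0 : 0 ≤ q := (norm_nonneg _).trans hq
  have hτ0 : 0 ≤ τ := (norm_nonneg _).trans hτ₁
  have hW : ‖((V₁ * V₂ * V₃⁻¹ : Rˣ) : R) - 1‖ ≤ q + τ := by
    rw [T4DirectionChart.path₃_eq_basePlaq_mul V₁ V₂ V₃ V₄, Units.val_mul]
    exact (norm_mul_unitaryLike_sub_one_le _ g₄).trans (add_le_add hq hτ₄)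
  have t₂ : ‖transport V₁ A₂‖ ≤ a := (g₁.norm_transport_le _).trans n₂
  have t₃ : ‖transport (V₁ * V₂ * V₃⁻¹) A₃‖ ≤ a := (gW.norm_transport_le _).trans n₃
  have t₄ : ‖transport (basePlaq V₁ V₂ V₃ V₄) A₄‖ ≤ a := (gP.norm_transport_le _).trans n₄
  have m₂ : ‖transport V₁ A₂ - A₂‖ ≤ 2 * τ * a :=
    (g₁.norm_transport_sub_self_le _).trans
      (mul_le_mul (mul_le_mul_of_nonneg_left hτ₁ (by norm_num)) n₂ (norm_nonneg _) (by positivity))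
  have m₃ : ‖A₃ - transport (V₁ * V₂ * V₃⁻¹) A₃‖ ≤ 2 * (q + τ) * a := by
    rw [norm_sub_rev]
    exact (gW.norm_transport_sub_self_le _).trans
      (mul_le_mul (mul_le_mul_of_nonneg_left hW (by norm_num)) n₃ (norm_nonneg _) (by positivity))
  have m₄ : ‖A₄ - transport (basePlaq V₁ V₂ V₃ V₄) A₄‖ ≤ 2 * q * a := by
    rw [norm_sub_rev]
    exact (gP.norm_transport_sub_self_le _).trans
      (mul_le_mul (mul_le_mul_of_nonneg_left hq (by norm_num)) n₄ (norm_nonneg _) (by positivity))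
  have e₁₃ : ‖A₁ - transport (V₁ * V₂ * V₃⁻¹) A₃‖ ≤ g + 2 * a * (q + τ) :=
    calc ‖A₁ - transport (V₁ * V₂ * V₃⁻¹) A₃‖
        ≤ ‖A₁ - A₃‖ + ‖A₃ - transport (V₁ * V₂ * V₃⁻¹) A₃‖ := norm_sub_le_norm_sub_add_norm_sub _ _ _
      _ ≤ g + 2 * (q + τ) * a := add_le_add d₁₃ m₃
      _ = g + 2 * a * (q + τ) := by ring
  have e₂₄ : ‖transport V₁ A₂ - transport (basePlaq V₁ V₂ V₃ V₄) A₄‖ ≤ g + 2 * a * (q + τ) :=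
    calc ‖transport V₁ A₂ - transport (basePlaq V₁ V₂ V₃ V₄) A₄‖
        ≤ ‖transport V₁ A₂ - A₂‖ + ‖A₂ - transport (basePlaq V₁ V₂ V₃ V₄) A₄‖ :=
          norm_sub_le_norm_sub_add_norm_sub _ _ _
      _ ≤ ‖transport V₁ A₂ - A₂‖ + (‖A₂ - A₄‖ + ‖A₄ - transport (basePlaq V₁ V₂ V₃ V₄) A₄‖) :=
          add_le_add le_rfl (norm_sub_le_norm_sub_add_norm_sub _ _ _)
      _ ≤ 2 * τ * a + (g + 2 * q * a) := add_le_add m₂ (add_le_add d₂₄ m₄)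
      _ = g + 2 * a * (q + τ) := by ring
  have hexp := B9Eq335Plaquette.norm_plaquette_exp_sub_one_le A₁ (transport V₁ A₂)
    (transport (V₁ * V₂ * V₃⁻¹) A₃) (transport (basePlaq V₁ V₂ V₃ V₄) A₄) n₁ t₂ t₃ t₄ e₁₃ e₂₄
  have hmv := T4DirectionChart.norm_movedPlaq_sub_one_le (1 : ℂ) V₁ V₂ V₃ V₄ A₁ A₂ A₃ A₄ gP.1
  simp only [one_smul] at hmv
  calc _ ≤ _ := hmv
    _ ≤ 2 * ((g + 2 * a * (q + τ)) + a ^ 2) * Real.exp (4 * a) + q := add_le_add hexp hq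
    _ = q + 2 * ((g + 2 * a * (q + τ)) + a ^ 2) * Real.exp (4 * a) := by ring

/-- **RELATIVE CURVATURE** [folklore]: `U₁ = e^{A}U₀` on the block with `‖A‖ ≤ a`, plain gradients of `A` `≤ g`,
`‖U₀(b) − 1‖ ≤ τ₀`, `‖plaq U₀ − 1‖ ≤ q₀`, `U₀` unitary-like ⟹
`‖plaq U₁ (y; ρ, ν) − 1‖ ≤ q₀ + 2((g + 2a(q₀ + τ₀)) + a²)e^{4a}` on the squares of the block
(`val_relPlaqWord_eq_movedPlaq` + `norm_relPlaq_sub_one_le` with `‖A(y)_ρ − A(y+e_ν)_ρ‖, ‖A(y+e_ρ)_ν − A(y)_ν‖ ≤ g`). -/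
theorem relCurv_le {U₀ U₁ : Cfg d R} {A : Site d → Fin d → R} {a g τ₀ q₀ : ℝ} (hu₀ : ∀ x ν, UnitaryLike (U₀ x ν))
    (he : IsExpRelOn L z U₀ U₁ A) (ha : ∀ x ρ, InBlock L z x → InBlock L z (x + e ρ) → ‖A x ρ‖ ≤ a)
    (hg : ∀ μ x ρ, InBlock L z x → InBlock L z (x + e ρ) → InBlock L z (x + e μ) →
      InBlock L z (x + e μ + e ρ) → ‖A (x + e μ) ρ - A x ρ‖ ≤ g)
    (hτ : ∀ x ρ, InBlock L z x → InBlock L z (x + e ρ) → ‖(U₀ x ρ : R) - 1‖ ≤ τ₀)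
    (hq : PlaqSup L z (fun y ρ ν => ‖(plaq U₀ y ρ ν : R) - 1‖) q₀) :
    PlaqSup L z (fun y ρ ν => ‖(plaq U₁ y ρ ν : R) - 1‖)
      (q₀ + 2 * ((g + 2 * a * (q₀ + τ₀)) + a ^ 2) * Real.exp (4 * a)) := by
  intro y ρ ν hρν h1 h2 h3 h4
  have h4' : InBlock L z (y + e ν + e ρ) := by rwa [add_right_comm]
  show ‖(plaq U₁ y ρ ν : R) - 1‖ ≤ q₀ + 2 * ((g + 2 * a * (q₀ + τ₀)) + a ^ 2) * Real.exp (4 * a)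
  have hw : (plaq U₁ y ρ ν : R) = movedPlaq 1 (U₀ y ρ) (U₀ (y + e ρ) ν) (U₀ (y + e ν) ρ) (U₀ y ν)
      (A y ρ) (A (y + e ρ) ν) (A (y + e ν) ρ) (A y ν) := by
    rw [← val_relPlaqWord_eq_movedPlaq]
    simp only [plaq, he y ρ h1 h2, he (y + e ρ) ν h2 h4, he (y + e ν) ρ h3 h4', he y ν h1 h3]
  rw [hw]
  have e₁₃ : ‖A y ρ - A (y + e ν) ρ‖ ≤ g := by
    rw [norm_sub_rev]
    exact hg ν y ρ h1 h2 h3 h4'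
  exact norm_relPlaq_sub_one_le (hu₀ _ _) (hu₀ _ _) (hu₀ _ _) (hu₀ _ _) _ _ _ _ (ha _ _ h1 h2) (ha _ _ h2 h4)
    (ha _ _ h3 h4') (ha _ _ h1 h3) (hq y ρ ν hρν h1 h2 h3 h4) (hτ y ρ h1 h2) (hτ y ν h1 h3) e₁₃
    (hg ρ y ν h1 h3 h2 h4)

/-- **FIVE RELATIVE SUPS GIVE THE SIX RAW SUPS** [folklore]: a unitary-like pair presented ON THE BLOCK in the product
form `U₁ = e^{A}U₀` with the five relative sups `r` has the six raw block sups `r.lift₆` (`relCurv_le`, `relBond_le`,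
`relGrad_le`; the background's three sups verbatim). -/
theorem RawSups₆.of_rel {U₀ U₁ : Cfg d R} {A : Site d → Fin d → R} {r : RelLetters}
    (hu₀ : ∀ x ν, UnitaryLike (U₀ x ν)) (hu₁ : ∀ x ν, UnitaryLike (U₁ x ν)) (he : IsExpRelOn L z U₀ U₁ A)
    (h : RelSups L z U₀ A r) : RawSups₆ L z U₀ U₁ r.lift₆ where
  unit₀ := hu₀
  unit₁ := hu₁
  curv₀ := h.curv₀
  curv₁ := relCurv_le hu₀ he h.supA h.gradA h.bond₀ h.curv₀
  bond₀ := h.bond₀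
  bond₁ := relBond_le hu₀ he h.supA h.nonneg.ha h.bond₀
  gradU₀ := h.gradU₀
  gradU₁ := relGrad_le hu₀ he h.supA h.gradA h.gradU₀
  nonneg := h.nonneg.lift₆

/-- [folklore] (arith) THE RELATIVE CONSTANT `relConst c = 2·potConst (c(1 + 4c))`. -/
noncomputable def relConst (c : ℝ) : ℝ := 2 * potConst (c * (1 + 4 * c))

/-- [folklore] (arith) `c ≤ c(1 + 4c)` for `0 ≤ c`. -/
theorem le_mul_one_add_four_mul {c : ℝ} (hc : 0 ≤ c) : c ≤ c * (1 + 4 * c) := by nlinarith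

/-- [folklore] (arith) `potConst (c(1+4c)) ≤ relConst c` and `c ≤ potConst (c(1+4c))` for `0 ≤ c`. -/
theorem potConst_le_relConst {c : ℝ} (hc : 0 ≤ c) :
    potConst (c * (1 + 4 * c)) ≤ relConst c ∧ c ≤ potConst (c * (1 + 4 * c)) := by
  have hc' : 0 ≤ c * (1 + 4 * c) := by positivity
  exact ⟨by unfold relConst; linarith [potConst_nonneg hc'], (le_mul_one_add_four_mul hc).trans (le_potConst hc')⟩

/-- [folklore] (arith) `1 ≤ relConst c` for `1 ≤ c`. -/
theorem one_le_relConst {c : ℝ} (hc : 1 ≤ c) : 1 ≤ relConst c := by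
  obtain ⟨h1, h2⟩ := potConst_le_relConst (zero_le_one.trans hc)
  linarith

/-- [folklore] (cell reading, NOT print) THE RELATIVE DICTIONARY at `θ`: `C ≤ c`; background `q₀ ≤ cθ²`, `τ₀ ≤ cθ`,
`γU₀ ≤ cθ²`; relative potential `a ≤ cθ`, `g ≤ cθ²` — the TYPE of (1.7) ∕ (3.35) for `U₀` and of (1.41) ∕ (1.36) for
`A` at the scale ratio `θ`.  NOT asserted for Bałaban's configurations. -/
structure DictR (θ c C : ℝ) (r : RelLetters) : Prop where
  count : C ≤ c
  curv₀ : r.q₀ ≤ c * θ ^ 2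
  bond₀ : r.τ₀ ≤ c * θ
  gradU₀ : r.γU₀ ≤ c * θ ^ 2
  supA : r.a ≤ c * θ
  gradA : r.g ≤ c * θ ^ 2

/-- [folklore] (cell reading, NOT print) THE RELATIVE DICTIONARY WITH THE SMALL-FIELD PARAMETER `ε`: `C ≤ c` and the
five letters `≤ ε·`(the bounds of `DictR`).  NOT asserted for Bałaban's configurations. -/
structure DictRE (θ ε c C : ℝ) (r : RelLetters) : Prop where
  count : C ≤ c
  curv₀ : r.q₀ ≤ ε * (c * θ ^ 2)
  bond₀ : r.τ₀ ≤ ε * (c * θ)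
  gradU₀ : r.γU₀ ≤ ε * (c * θ ^ 2)
  supA : r.a ≤ ε * (c * θ)
  gradA : r.g ≤ ε * (c * θ ^ 2)

/-- [folklore] At `ε = 1` the relative `ε`-dictionary is the relative dictionary. -/
theorem dictRE_one_iff {θ c C : ℝ} {r : RelLetters} : DictRE θ 1 c C r ↔ DictR θ c C r := by
  constructor
  · rintro ⟨h0, h1, h2, h3, h4, h5⟩
    exact ⟨h0, by simpa using h1, by simpa using h2, by simpa using h3, by simpa using h4, by simpa using h5⟩
  · rintro ⟨h0, h1, h2, h3, h4, h5⟩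
    exact ⟨h0, by simpa using h1, by simpa using h2, by simpa using h3, by simpa using h4, by simpa using h5⟩

/-- **THE RELATIVE `ε`-DICTIONARY GIVES THE SIX-LETTER ONE** [folklore] (arith) at the constant `relConst c`
(`0 < ε ≤ 1`, `0 < θ ≤ 1 ≤ c`, nonnegative letters): the effective gradient letter `g + 2a(q₀ + τ₀) ≤ ε·c(1+4c)·θ²`
(`θ² ≤ θ`, `ε² ≤ ε`), then `pot_arith` at `c(1+4c)` and `e^{a}·c ≤ potConst (c(1+4c))`. -/
theorem DictRE.lift {θ ε c C : ℝ} {r : RelLetters} (hε : 0 < ε) (hε1 : ε ≤ 1) (hθ : 0 < θ) (hθ1 : θ ≤ 1)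
    (hc1 : 1 ≤ c) (hn : r.Nonneg) (h : DictRE θ ε c C r) : Dict₆E θ ε (relConst c) C r.lift₆ := by
  have hc0 : 0 ≤ c := by linarith
  have hcc' : c ≤ c * (1 + 4 * c) := le_mul_one_add_four_mul hc0
  have hc1' : 1 ≤ c * (1 + 4 * c) := hc1.trans hcc'
  have hc0' : 0 ≤ c * (1 + 4 * c) := hc0.trans hcc'
  obtain ⟨hK1, hK2⟩ := potConst_le_relConst hc0
  have hcK : c ≤ relConst c := hK2.trans hK1
  have hε0 : 0 ≤ ε := hε.le
  have hθ0 : 0 ≤ θ := hθ.le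
  have hθ2 : θ ^ 2 ≤ θ := by nlinarith
  have hεε : ε * ε ≤ ε := mul_le_of_le_one_left hε0 hε1
  have hm : ε * (c * θ ^ 2) ≤ ε * (c * θ) := mul_le_mul_of_nonneg_left (mul_le_mul_of_nonneg_left hθ2 hc0) hε0
  have hεθ : 0 ≤ ε * (c * θ) := by positivity
  -- the effective gradient letter `δ = g + 2a(q₀ + τ₀)`
  have hδ : r.g + 2 * r.a * (r.q₀ + r.τ₀) ≤ ε * (c * (1 + 4 * c) * θ ^ 2) := by
    have h1 : r.q₀ + r.τ₀ ≤ 2 * (ε * (c * θ)) := by linarith [h.curv₀.trans hm, h.bond₀]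
    have h2 : 2 * r.a * (r.q₀ + r.τ₀) ≤ 2 * (ε * (c * θ)) * (2 * (ε * (c * θ))) :=
      mul_le_mul (by linarith [h.supA]) h1 (add_nonneg hn.hq₀ hn.hτ₀) (by positivity)
    have h3 : 2 * (ε * (c * θ)) * (2 * (ε * (c * θ))) ≤ ε * (4 * (c * c * θ ^ 2)) := by
      have hX : 0 ≤ 4 * (c * c * θ ^ 2) := by positivity
      calc 2 * (ε * (c * θ)) * (2 * (ε * (c * θ))) = (ε * ε) * (4 * (c * c * θ ^ 2)) := by ring
        _ ≤ ε * (4 * (c * c * θ ^ 2)) := mul_le_mul_of_nonneg_right hεε hX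
    calc r.g + 2 * r.a * (r.q₀ + r.τ₀) ≤ ε * (c * θ ^ 2) + ε * (4 * (c * c * θ ^ 2)) := by
          linarith [h.gradA, h2, h3]
      _ = ε * (c * (1 + 4 * c) * θ ^ 2) := by ring
  have ha' : r.a ≤ ε * (c * (1 + 4 * c) * θ) :=
    h.supA.trans (mul_le_mul_of_nonneg_left (mul_le_mul_of_nonneg_right hcc' hθ0) hε0)
  obtain ⟨q1, t1, g1⟩ := pot_arith hε hε1 hθ hθ1 hc1' hn.ha ha' hδ
  -- `e^{a}·c ≤ potConst (c(1+4c))`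
  have hea : Real.exp r.a * c ≤ potConst (c * (1 + 4 * c)) := by
    have hac : r.a ≤ c * (1 + 4 * c) := by
      refine ha'.trans ?_
      calc ε * (c * (1 + 4 * c) * θ) ≤ 1 * (c * (1 + 4 * c) * θ) :=
            mul_le_mul_of_nonneg_right hε1 (mul_nonneg hc0' hθ0)
        _ = c * (1 + 4 * c) * θ := one_mul _
        _ ≤ c * (1 + 4 * c) * 1 := mul_le_mul_of_nonneg_left hθ1 hc0'
        _ = c * (1 + 4 * c) := mul_one _
    calc Real.exp r.a * c ≤ Real.exp (c * (1 + 4 * c)) * (c * (1 + 4 * c)) :=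
          mul_le_mul (Real.exp_le_exp.mpr hac) hcc' hc0 (Real.exp_pos _).le
      _ = (c * (1 + 4 * c)) * Real.exp (c * (1 + 4 * c)) := mul_comm _ _
      _ ≤ potConst (c * (1 + 4 * c)) := mul_exp_le_potConst hc0'
  have hK2θ : ε * (c * θ) ≤ ε * (potConst (c * (1 + 4 * c)) * θ) :=
    mul_le_mul_of_nonneg_left (mul_le_mul_of_nonneg_right hK2 hθ0) hε0
  have hK2θ2 : ε * (c * θ ^ 2) ≤ ε * (potConst (c * (1 + 4 * c)) * θ ^ 2) :=
    mul_le_mul_of_nonneg_left (mul_le_mul_of_nonneg_right hK2 (pow_nonneg hθ0 2)) hε0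
  have hcKθ : ε * (c * θ) ≤ ε * (relConst c * θ) :=
    mul_le_mul_of_nonneg_left (mul_le_mul_of_nonneg_right hcK hθ0) hε0
  have hcKθ2 : ε * (c * θ ^ 2) ≤ ε * (relConst c * θ ^ 2) :=
    mul_le_mul_of_nonneg_left (mul_le_mul_of_nonneg_right hcK (pow_nonneg hθ0 2)) hε0
  refine ⟨h.count.trans hcK, ?_, ?_, ?_, ?_, ?_, ?_⟩
  · show r.q₀ ≤ ε * (relConst c * θ ^ 2)
    exact h.curv₀.trans hcKθ2
  · show r.q₀ + 2 * ((r.g + 2 * r.a * (r.q₀ + r.τ₀)) + r.a ^ 2) * Real.exp (4 * r.a) ≤ ε * (relConst c * θ ^ 2)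
    calc _ ≤ ε * (potConst (c * (1 + 4 * c)) * θ ^ 2) + ε * (potConst (c * (1 + 4 * c)) * θ ^ 2) :=
          add_le_add (h.curv₀.trans hK2θ2) q1
      _ = ε * (relConst c * θ ^ 2) := by unfold relConst; ring
  · show r.τ₀ ≤ ε * (relConst c * θ)
    exact h.bond₀.trans hcKθ
  · show r.a * Real.exp r.a + r.τ₀ ≤ ε * (relConst c * θ)
    calc _ ≤ ε * (potConst (c * (1 + 4 * c)) * θ) + ε * (potConst (c * (1 + 4 * c)) * θ) :=
          add_le_add t1 (h.bond₀.trans hK2θ)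
      _ = ε * (relConst c * θ) := by unfold relConst; ring
  · show r.γU₀ ≤ ε * (relConst c * θ ^ 2)
    exact h.gradU₀.trans hcKθ2
  · show r.g * Real.exp r.a + Real.exp r.a * r.γU₀ ≤ ε * (relConst c * θ ^ 2)
    have hg' : r.g * Real.exp r.a ≤ (r.g + 2 * r.a * (r.q₀ + r.τ₀)) * Real.exp r.a := by
      have : 0 ≤ 2 * r.a * (r.q₀ + r.τ₀) := by positivity [hn.ha, hn.hq₀, hn.hτ₀]
      exact mul_le_mul_of_nonneg_right (by linarith) (Real.exp_pos _).le
    have hγ : Real.exp r.a * r.γU₀ ≤ ε * (potConst (c * (1 + 4 * c)) * θ ^ 2) :=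
      calc Real.exp r.a * r.γU₀ ≤ Real.exp r.a * (ε * (c * θ ^ 2)) :=
            mul_le_mul_of_nonneg_left h.gradU₀ (Real.exp_pos _).le
        _ = ε * ((Real.exp r.a * c) * θ ^ 2) := by ring
        _ ≤ ε * (potConst (c * (1 + 4 * c)) * θ ^ 2) :=
            mul_le_mul_of_nonneg_left (mul_le_mul_of_nonneg_right hea (pow_nonneg hθ0 2)) hε0
    calc _ ≤ ε * (potConst (c * (1 + 4 * c)) * θ ^ 2) + ε * (potConst (c * (1 + 4 * c)) * θ ^ 2) :=
          add_le_add (hg'.trans g1) hγ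
      _ = ε * (relConst c * θ ^ 2) := by unfold relConst; ring

/-- [folklore] (arith) At `ε = 1`: the relative dictionary gives the six-letter dictionary at `relConst c`. -/
theorem DictR.lift {θ c C : ℝ} {r : RelLetters} (hθ : 0 < θ) (hθ1 : θ ≤ 1) (hc1 : 1 ≤ c) (hn : r.Nonneg)
    (h : DictR θ c C r) : Dict₆ θ (relConst c) C r.lift₆ :=
  dict₆E_one_iff.1 ((dictRE_one_iff.2 h).lift one_pos le_rfl hθ hθ1 hc1 hn)

/-- [folklore] THE PER-PAIR PRODUCER FROM FIVE RELATIVE SUPS: a unitary-like pair presented on the block in the product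
form with relative sups obeying the relative `ε`-dictionary at `θ` (`0 < ε ≤ 1`, `0 < θ ≤ 1 ≤ c`, `0 ≤ β ≤ 1`,
`0 ≤ (d−1)(L−1)`, `L ≤ Λ`, `1 ≤ Λ`) ⟹ SOME window data `b_w` of the comb-gauge block deviation with
`N_{(1,1,1)}(b_w) ≤ ε·sockConst (16·relConst c) Λ·θ²`. -/
theorem exists_windowData_unitRel_eps {U₀ U₁ : Cfg d R} {A : Site d → Fin d → R} {β θ ε c Λ : ℝ}
    {r : RelLetters} (hε : 0 < ε) (hε1 : ε ≤ 1) (hθ : 0 < θ) (hθ1 : θ ≤ 1) (hβ0 : 0 ≤ β) (hβ1 : β ≤ 1)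
    (hc1 : 1 ≤ c) (hΛ : 1 ≤ Λ) (hL : (L : ℝ) ≤ Λ) (hC0 : 0 ≤ ((d : ℝ) - 1) * ((L : ℝ) - 1))
    (hu₀ : ∀ x ν, UnitaryLike (U₀ x ν)) (hu₁ : ∀ x ν, UnitaryLike (U₁ x ν)) (he : IsExpRelOn L z U₀ U₁ A)
    (h : RelSups L z U₀ A r) (hD : DictRE θ ε c (((d : ℝ) - 1) * ((L : ℝ) - 1)) r) :
    ∃ bw : Win, WindowData L z β (blockDev L z (combGauge U₀ U₁ z) U₀ U₁) bw ∧
      winN unitWin bw ≤ ε * sockConst (16 * relConst c) Λ * θ ^ 2 :=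
  exists_windowData_unit₆_eps hε hε1 hθ hθ1 hβ0 hβ1 (one_le_relConst hc1) hΛ hL hC0
    (RawSups₆.of_rel hu₀ hu₁ he h) (hD.lift hε hε1 hθ hθ1 hc1 h.nonneg)

/-! ### §4.1  The covariant gradient of (1.36) — cell question (u1) in kernel for this presentation -/

/-- [folklore] THE FIVE RAW RELATIVE SUPS WITH THE COVARIANT GRADIENT: as `RelSups`, the gradient field replaced by the
COVARIANT lattice gradient of the relative potential over the background, the value at `x + e_μ` transported back to
`x` along the bond `⟨x, x+e_μ⟩`: `‖U₀⟨x,x+e_μ⟩·A(x+e_μ)_ρ·U₀⟨x,x+e_μ⟩⁻¹ − A(x)_ρ‖ ≤ g` (`T4DirectionChart.transport`;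
the convention of `T4DirectionChart.covSum'`).  The printed TYPE of B8 (1.36)'s «|∇^η_{U₀}A| < B₁(α₀+α₁)(L^jη)^{−2}»
(module header; TYPE only, the print's covariant-derivative convention is not re-read here).  NOT asserted for any
configuration of the papers. -/
structure RelSupsCov (L : ℕ) (z : Site d) (U₀ : Cfg d R) (A : Site d → Fin d → R) (r : RelLetters) : Prop where
  curv₀ : PlaqSup L z (fun y ρ ν => ‖(plaq U₀ y ρ ν : R) - 1‖) r.q₀
  bond₀ : ∀ x ρ, InBlock L z x → InBlock L z (x + e ρ) → ‖(U₀ x ρ : R) - 1‖ ≤ r.τ₀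
  gradU₀ : ∀ μ x ρ, InBlock L z x → InBlock L z (x + e ρ) → InBlock L z (x + e μ) →
    InBlock L z (x + e μ + e ρ) → ‖(U₀ (x + e μ) ρ : R) - U₀ x ρ‖ ≤ r.γU₀
  supA : ∀ x ρ, InBlock L z x → InBlock L z (x + e ρ) → ‖A x ρ‖ ≤ r.a
  gradAcov : ∀ μ x ρ, InBlock L z x → InBlock L z (x + e ρ) → InBlock L z (x + e μ) →
    InBlock L z (x + e μ + e ρ) → ‖transport (U₀ x μ) (A (x + e μ) ρ) - A x ρ‖ ≤ r.g
  nonneg : r.Nonneg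

/-- [folklore] The relative letters with the gradient letter enlarged by the plain-vs-covariant cross term `2aτ₀`. -/
noncomputable def RelLetters.plainOfCov (r : RelLetters) : RelLetters :=
  ⟨r.q₀, r.τ₀, r.γU₀, r.a, r.g + 2 * r.a * r.τ₀⟩

/-- [folklore] Nonnegativity is preserved by `plainOfCov`. -/
theorem RelLetters.Nonneg.plainOfCov {r : RelLetters} (h : r.Nonneg) : r.plainOfCov.Nonneg := by
  obtain ⟨hq₀, hτ₀, hγU₀, ha, hg⟩ := h
  exact ⟨hq₀, hτ₀, hγU₀, ha, by show 0 ≤ r.g + 2 * r.a * r.τ₀; positivity⟩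

omit [NormOneClass R] [NormedAlgebra ℂ R] [CompleteSpace R] in
/-- **COVARIANT GIVES PLAIN AT THE SAME ORDER** [folklore]: for a unitary-like background,
`‖A(x+e_μ)_ρ − A(x)_ρ‖ ≤ ‖A(x+e_μ)_ρ − u·A(x+e_μ)_ρ·u⁻¹‖ + ‖u·A(x+e_μ)_ρ·u⁻¹ − A(x)_ρ‖ ≤ 2τ₀a + g`, `u = U₀⟨x,x+e_μ⟩`
(`GUnit.norm_transport_sub_self_le`): the covariant relative sups give the plain ones with `g ↦ g + 2aτ₀` — the
plain-vs-covariant remark of `B9Eq335Plaquette`'s header (same order) in kernel for the relative presentation. -/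
theorem RelSupsCov.toRelSups {U₀ : Cfg d R} {A : Site d → Fin d → R} {r : RelLetters}
    (hu₀ : ∀ x ν, UnitaryLike (U₀ x ν)) (h : RelSupsCov L z U₀ A r) : RelSups L z U₀ A r.plainOfCov where
  curv₀ := h.curv₀
  bond₀ := h.bond₀
  gradU₀ := h.gradU₀
  supA := h.supA
  gradA := by
    intro μ x ρ h1 h2 h3 h4
    show ‖A (x + e μ) ρ - A x ρ‖ ≤ r.g + 2 * r.a * r.τ₀
    have hτ0 : 0 ≤ r.τ₀ := h.nonneg.hτ₀
    have e1 : ‖A (x + e μ) ρ - transport (U₀ x μ) (A (x + e μ) ρ)‖ ≤ 2 * r.τ₀ * r.a := by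
      rw [norm_sub_rev]
      exact ((hu₀ x μ).norm_transport_sub_self_le _).trans
        (mul_le_mul (mul_le_mul_of_nonneg_left (h.bond₀ x μ h1 h3) (by norm_num)) (h.supA _ _ h3 h4)
          (norm_nonneg _) (by positivity))
    calc ‖A (x + e μ) ρ - A x ρ‖ ≤ ‖A (x + e μ) ρ - transport (U₀ x μ) (A (x + e μ) ρ)‖ +
          ‖transport (U₀ x μ) (A (x + e μ) ρ) - A x ρ‖ := norm_sub_le_norm_sub_add_norm_sub _ _ _
      _ ≤ 2 * r.τ₀ * r.a + r.g := add_le_add e1 (h.gradAcov μ x ρ h1 h2 h3 h4)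
      _ = r.g + 2 * r.a * r.τ₀ := by ring
  nonneg := h.nonneg.plainOfCov

/-- [folklore] (arith) The relative `ε`-dictionary survives `plainOfCov` at `c ↦ c(1 + 2c)` (`0 ≤ ε ≤ 1`, `0 ≤ θ`,
`0 ≤ c`, nonnegative letters): `g + 2aτ₀ ≤ ε cθ² + 2ε²c²θ² ≤ ε·c(1+2c)·θ²`. -/
theorem DictRE.plainOfCov {θ ε c C : ℝ} {r : RelLetters} (hε : 0 ≤ ε) (hε1 : ε ≤ 1) (hθ : 0 ≤ θ) (hc : 0 ≤ c)
    (hn : r.Nonneg) (h : DictRE θ ε c C r) : DictRE θ ε (c * (1 + 2 * c)) C r.plainOfCov := by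
  have hcc : c ≤ c * (1 + 2 * c) := by nlinarith
  have hm1 : ε * (c * θ) ≤ ε * (c * (1 + 2 * c) * θ) :=
    mul_le_mul_of_nonneg_left (mul_le_mul_of_nonneg_right hcc hθ) hε
  have hm2 : ε * (c * θ ^ 2) ≤ ε * (c * (1 + 2 * c) * θ ^ 2) :=
    mul_le_mul_of_nonneg_left (mul_le_mul_of_nonneg_right hcc (pow_nonneg hθ 2)) hε
  refine ⟨h.count.trans hcc, h.curv₀.trans hm2, h.bond₀.trans hm1, h.gradU₀.trans hm2, h.supA.trans hm1, ?_⟩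
  show r.g + 2 * r.a * r.τ₀ ≤ ε * (c * (1 + 2 * c) * θ ^ 2)
  have hεθ : 0 ≤ ε * (c * θ) := by positivity
  have h2 : 2 * r.a * r.τ₀ ≤ 2 * (ε * (c * θ)) * (ε * (c * θ)) :=
    mul_le_mul (by linarith [h.supA]) h.bond₀ hn.hτ₀ (by positivity)
  have h3 : 2 * (ε * (c * θ)) * (ε * (c * θ)) ≤ ε * (2 * (c * c * θ ^ 2)) := by
    have hX : 0 ≤ 2 * (c * c * θ ^ 2) := by positivity
    calc 2 * (ε * (c * θ)) * (ε * (c * θ)) = (ε * ε) * (2 * (c * c * θ ^ 2)) := by ring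
      _ ≤ ε * (2 * (c * c * θ ^ 2)) := mul_le_mul_of_nonneg_right (mul_le_of_le_one_left hε hε1) hX
  calc r.g + 2 * r.a * r.τ₀ ≤ ε * (c * θ ^ 2) + ε * (2 * (c * c * θ ^ 2)) := by linarith [h.gradA, h2, h3]
    _ = ε * (c * (1 + 2 * c) * θ ^ 2) := by ring

end Rel

section RelSocket

variable [NormOneClass R] [NormedAlgebra ℂ R] [CompleteSpace R] {F : Type*} [NormedAddCommGroup F]
  [NormedSpace ℂ F] [CompleteSpace F]
variable {B : Booking} {T : Trajectory B}

/-- **THE RELATIVE FEED ⟹ `TransportsFrom`** [folklore] (= `transportsFrom_of_combRaw₆_eps` at the constant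
`relConst c`, the feed mapped through `RawSups₆.of_rel` ∕ `DictRE.lift`; weights `(1,1,1)`,
`c_δ = ε·sockConst (16·relConst c) Λ`, `ψ = ϑ²`).  THE FEED, per consumer block of history depth `k − k′` below a
passed gate and per `ε′ > 0`: a unitary-like attaining pair `(U₀, U₁)` with `val U₀ ∈ 𝒦 b k′`, the second
configuration presented ON THE BLOCK in the product form `U₁ = e^{A}·U₀` (`IsExpRelOn`), the background's three raw
block sups and the relative potential's sup and PLAIN lattice gradient (`RelSups`) obeying
`DictRE (ϑ^{k−k′}) ε c ((d−1)(Lg b k′−1))` — `q₀, γU₀, g ≤ ε·cθ²`, `τ₀, a ≤ ε·cθ`, `θ = ϑ^{k−k′}` (the TYPE of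
B8 (1.7) ∕ B9 (3.35) for the background, of B8 (1.41) ∕ (1.36) for the relative potential); window hypothesis
`ε·sockConst (16·relConst c) Λ ≤ w`.  NOT asserted for the cell's terms: every input is a binder ((W2″) of GAPS
G-pv24g16-2 ∕ -2a in the printed lettering, NOT discharged). -/
theorem transportsFrom_of_combRel_eps {Gate : ℕ → Prop} {Fn : B.Birth → ℕ → Fld d R → F}
    {Lg : B.Birth → ℕ → ℕ} {zg : B.Birth → ℕ → Site d} {𝒦 : B.Birth → ℕ → Set (Fld d R)}
    {β : ℝ} {w r ε c Λ ϑ : ℝ}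
    (hinv : ∀ b k', GaugeInvariant (BlockRel (Lg b k') (zg b k')) (Fn b k'))
    (hsl : ∀ b k', BirthSlice (Fn b k') (wMove (Lg b k') (zg b k') β) (wN (Lg b k') (zg b k') β unitWin) (𝒦 b k')
      w r (T.gen b k'))
    (hr : 0 < r) (hε : 0 < ε) (hε1 : ε ≤ 1) (hβ0 : 0 ≤ β) (hβ1 : β ≤ 1) (hc1 : 1 ≤ c) (hΛ : 1 ≤ Λ) (hϑ : 0 < ϑ)
    (hϑ1 : ϑ ≤ 1) (hw : ε * sockConst (16 * relConst c) Λ ≤ w) (hL : ∀ b k', (Lg b k' : ℝ) ≤ Λ)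
    (hCnn : ∀ b k', 0 ≤ ((d : ℝ) - 1) * ((Lg b k' : ℝ) - 1))
    (hCc : ∀ b k', ((d : ℝ) - 1) * ((Lg b k' : ℝ) - 1) ≤ c)
    (hfeed : ∀ (b : B.Birth) (k' k : ℕ), B.birthScale b ≤ k' → k' ≤ k → k ≤ B.K → RanBelow Gate k → ∀ ε' > 0,
      ∃ U₀ U₁ : Cfg d R, ∃ A : Site d → Fin d → R, ∃ rl : RelLetters, val U₀ ∈ 𝒦 b k' ∧
        (∀ x ν, UnitaryLike (U₀ x ν)) ∧ (∀ x ν, UnitaryLike (U₁ x ν)) ∧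
        IsExpRelOn (Lg b k') (zg b k') U₀ U₁ A ∧ RelSups (Lg b k') (zg b k') U₀ A rl ∧
        DictRE (ϑ ^ (k - k')) ε c (((d : ℝ) - 1) * ((Lg b k' : ℝ) - 1)) rl ∧
        T.lin b k' k ≤ ‖Fn b k' (val U₁) - Fn b k' (val U₀)‖ + ε') :
    T.TransportsFrom (4 * (ε * sockConst (16 * relConst c) Λ) / r) (ϑ ^ 2) Gate := by
  have hc0 : (0 : ℝ) ≤ c := by linarith
  obtain ⟨hK1, hK2⟩ := potConst_le_relConst hc0
  refine transportsFrom_of_combRaw₆_eps hinv hsl hr hε hε1 hβ0 hβ1 (one_le_relConst hc1) hΛ hϑ hϑ1 hw hL hCnn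
    (fun b k' => (hCc b k').trans (hK2.trans hK1)) ?_
  intro b k' k hbk' hk'k hk hran ε' hε'
  obtain ⟨U₀, U₁, A, rl, hK, hu₀, hu₁, he, hS, hD, hle⟩ := hfeed b k' k hbk' hk'k hk hran ε' hε'
  exact ⟨U₀, U₁, rl.lift₆, hK, RawSups₆.of_rel hu₀ hu₁ he hS,
    hD.lift hε hε1 (pow_pos hϑ _) (pow_le_one₀ hϑ.le hϑ1) hc1 hS.nonneg, hle⟩

/-- **THE COVARIANT RELATIVE FEED ⟹ `TransportsFrom`** [folklore] (= `transportsFrom_of_combRel_eps` at `c(1+2c)`,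
the feed mapped through `RelSupsCov.toRelSups` ∕ `DictRE.plainOfCov`): as above with the COVARIANT lattice gradient
of the relative potential over the background (`RelSupsCov` — the lettering of (1.36) up to the cell's transport
convention); window hypothesis `ε·sockConst (16·relConst (c(1+2c))) Λ ≤ w`.  NOT asserted for the cell's terms. -/
theorem transportsFrom_of_combRelCov_eps {Gate : ℕ → Prop} {Fn : B.Birth → ℕ → Fld d R → F}
    {Lg : B.Birth → ℕ → ℕ} {zg : B.Birth → ℕ → Site d} {𝒦 : B.Birth → ℕ → Set (Fld d R)}
    {β : ℝ} {w r ε c Λ ϑ : ℝ}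
    (hinv : ∀ b k', GaugeInvariant (BlockRel (Lg b k') (zg b k')) (Fn b k'))
    (hsl : ∀ b k', BirthSlice (Fn b k') (wMove (Lg b k') (zg b k') β) (wN (Lg b k') (zg b k') β unitWin) (𝒦 b k')
      w r (T.gen b k'))
    (hr : 0 < r) (hε : 0 < ε) (hε1 : ε ≤ 1) (hβ0 : 0 ≤ β) (hβ1 : β ≤ 1) (hc1 : 1 ≤ c) (hΛ : 1 ≤ Λ) (hϑ : 0 < ϑ)
    (hϑ1 : ϑ ≤ 1) (hw : ε * sockConst (16 * relConst (c * (1 + 2 * c))) Λ ≤ w)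
    (hL : ∀ b k', (Lg b k' : ℝ) ≤ Λ) (hCnn : ∀ b k', 0 ≤ ((d : ℝ) - 1) * ((Lg b k' : ℝ) - 1))
    (hCc : ∀ b k', ((d : ℝ) - 1) * ((Lg b k' : ℝ) - 1) ≤ c)
    (hfeed : ∀ (b : B.Birth) (k' k : ℕ), B.birthScale b ≤ k' → k' ≤ k → k ≤ B.K → RanBelow Gate k → ∀ ε' > 0,
      ∃ U₀ U₁ : Cfg d R, ∃ A : Site d → Fin d → R, ∃ rl : RelLetters, val U₀ ∈ 𝒦 b k' ∧
        (∀ x ν, UnitaryLike (U₀ x ν)) ∧ (∀ x ν, UnitaryLike (U₁ x ν)) ∧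
        IsExpRelOn (Lg b k') (zg b k') U₀ U₁ A ∧ RelSupsCov (Lg b k') (zg b k') U₀ A rl ∧
        DictRE (ϑ ^ (k - k')) ε c (((d : ℝ) - 1) * ((Lg b k' : ℝ) - 1)) rl ∧
        T.lin b k' k ≤ ‖Fn b k' (val U₁) - Fn b k' (val U₀)‖ + ε') :
    T.TransportsFrom (4 * (ε * sockConst (16 * relConst (c * (1 + 2 * c))) Λ) / r) (ϑ ^ 2) Gate := by
  have hc0 : (0 : ℝ) ≤ c := by linarith
  have hcc : c ≤ c * (1 + 2 * c) := by nlinarith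
  refine transportsFrom_of_combRel_eps hinv hsl hr hε hε1 hβ0 hβ1 (hc1.trans hcc) hΛ hϑ hϑ1 hw hL hCnn
    (fun b k' => (hCc b k').trans hcc) ?_
  intro b k' k hbk' hk'k hk hran ε' hε'
  obtain ⟨U₀, U₁, A, rl, hK, hu₀, hu₁, he, hS, hD, hle⟩ := hfeed b k' k hbk' hk'k hk hran ε' hε'
  exact ⟨U₀, U₁, A, rl.plainOfCov, hK, hu₀, hu₁, he, hS.toRelSups hu₀,
    hD.plainOfCov hε.le hε1 (pow_nonneg hϑ.le _) hc0 hS.nonneg, hle⟩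

/-- **END TO END WITH THE RELATIVE `ε`-FEED (strict product, bounded weights — K-UNIFORM)** [folklore]
(= `latticeTrajectory_budget_combPot_eps_strict` with the relative feed: `transportsFrom_of_combRel_eps` under the
history of the returned gate `(TOB-k) ∧ H`, then
`T4TrajectoryComparison.Trajectory.sizeBound_cubeBudget_of_trajectory_strict` BY NAME; any
`C ≥ 4·(ε·sockConst (16·relConst c) Λ)/r`).  NOT asserted for the cell's terms. -/
theorem latticeTrajectory_budget_combRel_eps_strict {Fn : B.Birth → ℕ → Fld d R → F}
    {Lg : B.Birth → ℕ → ℕ} {zg : B.Birth → ℕ → Site d} {𝒦 : B.Birth → ℕ → Set (Fld d R)}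
    {β : ℝ} {w r ε c Λ ϑ : ℝ} {N : ℕ → ℕ → ℝ} {wt : ℕ → ℝ} {N₀ Λc wbar C cR Ahat τ r' : ℝ} {H : ℕ → Prop}
    (hinv : ∀ b k', GaugeInvariant (BlockRel (Lg b k') (zg b k')) (Fn b k'))
    (hsl : ∀ b k', BirthSlice (Fn b k') (wMove (Lg b k') (zg b k') β) (wN (Lg b k') (zg b k') β unitWin) (𝒦 b k')
      w r (T.gen b k'))
    (hr : 0 < r) (hε : 0 < ε) (hε1 : ε ≤ 1) (hβ0 : 0 ≤ β) (hβ1 : β ≤ 1) (hc1 : 1 ≤ c) (hΛ : 1 ≤ Λ) (hϑ : 0 < ϑ)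
    (hϑ1 : ϑ ≤ 1) (hww : ε * sockConst (16 * relConst c) Λ ≤ w) (hL : ∀ b k', (Lg b k' : ℝ) ≤ Λ)
    (hCnn : ∀ b k', 0 ≤ ((d : ℝ) - 1) * ((Lg b k' : ℝ) - 1))
    (hCc : ∀ b k', ((d : ℝ) - 1) * ((Lg b k' : ℝ) - 1) ≤ c)
    (hCle : 4 * (ε * sockConst (16 * relConst c) Λ) / r ≤ C)
    (hfeed : ∀ (b : B.Birth) (k' k : ℕ), B.birthScale b ≤ k' → k' ≤ k → k ≤ B.K →
      RanBelow (fun i => CubeBudgetAt B wt ((N₀ * (C * Ahat)) * wbar * (1 - r')⁻¹) i ∧ H i) k → ∀ ε' > 0,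
      ∃ U₀ U₁ : Cfg d R, ∃ A : Site d → Fin d → R, ∃ rl : RelLetters, val U₀ ∈ 𝒦 b k' ∧
        (∀ x ν, UnitaryLike (U₀ x ν)) ∧ (∀ x ν, UnitaryLike (U₁ x ν)) ∧
        IsExpRelOn (Lg b k') (zg b k') U₀ U₁ A ∧ RelSups (Lg b k') (zg b k') U₀ A rl ∧
        DictRE (ϑ ^ (k - k')) ε c (((d : ℝ) - 1) * ((Lg b k' : ℝ) - 1)) rl ∧
        T.lin b k' k ≤ ‖Fn b k' (val U₁) - Fn b k' (val U₀)‖ + ε')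
    (hw : ∀ j, j ≤ B.K → 0 ≤ wt j) (hwb : ∀ j, j ≤ B.K → wt j ≤ wbar) (hN : B.PositionalCount N)
    (hNle : ∀ j k, j ≤ k → k ≤ B.K → N j k ≤ N₀ * Λc ^ (k - j)) (hN₀ : 0 ≤ N₀) (hΛc : 0 ≤ Λc)
    (hcR : 0 ≤ cR) (hAhat : 0 ≤ Ahat) (hτ0 : 0 ≤ τ) (hτ1 : τ ≤ 1)
    (hprod : Λc * (ϑ ^ 2 + C * cR) * τ ≤ r') (hr'1 : r' < 1) (h0 : T.BirthGen Ahat τ)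
    (hreg : T.RegeneratesFrom cR (fun k => CubeBudgetAt B wt ((N₀ * (C * Ahat)) * wbar * (1 - r')⁻¹) k ∧ H k))
    (hH : GateOfSizes B (twoRate B.K (C * Ahat) (ϑ ^ 2 + C * cR) τ) H) :
    B.SizeBound (twoRate B.K (C * Ahat) (ϑ ^ 2 + C * cR) τ) ∧
      B.CubeBudget wt ((N₀ * (C * Ahat)) * wbar * (1 - r')⁻¹) ∧ ∀ k, k ≤ B.K → H k := by
  have hΛ0 : 0 ≤ Λ := zero_le_one.trans hΛ
  have hψ : (0 : ℝ) ≤ ϑ ^ 2 := pow_nonneg hϑ.le 2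
  have hK0 : (1 : ℝ) ≤ 16 * relConst c := by have := one_le_relConst hc1; linarith
  have hC0 : 0 ≤ 4 * (ε * sockConst (16 * relConst c) Λ) / r :=
    div_nonneg (mul_nonneg (by norm_num) (mul_nonneg hε.le (sockConst_nonneg (zero_le_one.trans hK0) hΛ0))) hr.le
  have hCC : 0 ≤ C := hC0.trans hCle
  have htr := (transportsFrom_of_combRel_eps hinv hsl hr hε hε1 hβ0 hβ1 hc1 hΛ hϑ hϑ1 hww hL hCnn hCc
    hfeed).mono hCle hψ le_rfl hCC
  exact Trajectory.sizeBound_cubeBudget_of_trajectory_strict hw hwb hN hNle hN₀ hΛc hCC hψ hcR hAhat hτ0 hτ1 hprod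
    hr'1 h0 htr hreg hH

end RelSocket

/-! ## §5  [folklore] Non-vacuity of the relative feed -/

section RelWitness

variable [NormOneClass R] [NormedAlgebra ℂ R] [CompleteSpace R] {L : ℕ} {z : Site d}

/-- [folklore] The zero relative letters. -/
def RelLetters.zero : RelLetters := ⟨0, 0, 0, 0, 0⟩

/-- [folklore] The zero relative letters are nonnegative. -/
theorem RelLetters.zero_nonneg : RelLetters.zero.Nonneg := ⟨le_rfl, le_rfl, le_rfl, le_rfl, le_rfl⟩

/-- [folklore] The zero relative letters obey the `ε`-dictionary for any `0 ≤ ε`, `0 ≤ θ`, `0 ≤ c`, `C ≤ c`. -/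
theorem dictRE_zero {θ ε c C : ℝ} (hε : 0 ≤ ε) (hθ : 0 ≤ θ) (hc : 0 ≤ c) (hC : C ≤ c) :
    DictRE θ ε c C RelLetters.zero :=
  ⟨hC, by show (0 : ℝ) ≤ _; positivity, by show (0 : ℝ) ≤ _; positivity, by show (0 : ℝ) ≤ _; positivity,
    by show (0 : ℝ) ≤ _; positivity, by show (0 : ℝ) ≤ _; positivity⟩

omit [NormedAlgebra ℂ R] [CompleteSpace R] in
/-- [folklore] `1` is unitary-like (`‖1‖ = 1`). -/
theorem unitaryLike_one : UnitaryLike (1 : Rˣ) :=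
  ⟨by simp, by simp⟩

omit [NormOneClass R] [NormedAlgebra ℂ R] [CompleteSpace R] in
/-- [folklore] The trivial background `U₀ ≡ 1` with the zero relative potential has all five relative sups `0`. -/
theorem relSups_one_zero (L : ℕ) (z : Site d) :
    RelSups (R := R) L z (fun _ _ => 1) (fun _ _ => 0) RelLetters.zero :=
  ⟨fun _ _ _ _ _ _ _ _ => by simp [plaq, RelLetters.zero], fun _ _ _ _ => by simp [RelLetters.zero],
    fun _ _ _ _ _ _ _ => by simp [RelLetters.zero], fun _ _ _ _ => by simp [RelLetters.zero],
    fun _ _ _ _ _ _ _ => by simp [RelLetters.zero], RelLetters.zero_nonneg⟩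

omit [NormOneClass R] [NormedAlgebra ℂ R] [CompleteSpace R] in
/-- [folklore] … and all five COVARIANT relative sups `0` (`u·0·u⁻¹ = 0`). -/
theorem relSupsCov_one_zero (L : ℕ) (z : Site d) :
    RelSupsCov (R := R) L z (fun _ _ => 1) (fun _ _ => 0) RelLetters.zero :=
  ⟨fun _ _ _ _ _ _ _ _ => by simp [plaq, RelLetters.zero], fun _ _ _ _ => by simp [RelLetters.zero],
    fun _ _ _ _ _ _ _ => by simp [RelLetters.zero], fun _ _ _ _ => by simp [RelLetters.zero],
    fun _ _ _ _ _ _ _ => by simp [RelLetters.zero, T4DirectionChart.transport], RelLetters.zero_nonneg⟩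

omit [NormOneClass R] in
/-- [folklore] The configuration `U₁ ≡ e^{0}·1` is presented over `U₀ ≡ 1` by the zero relative potential. -/
theorem isExpRelOn_zero (L : ℕ) (z : Site d) :
    IsExpRelOn (R := R) L z (fun _ _ => 1) (fun _ _ => expUnit 0 * 1) (fun _ _ => 0) := fun _ _ _ _ => rfl

/-- [folklore] NON-VACUITY OF THE RELATIVE FEED's per-pair content: the pair `U₀ ≡ 1`, `U₁ ≡ e^{0}·1` with the zero
relative potential has window data of its comb-gauge deviation inside the unit-weight window at the rate
`ε·sockConst (16·relConst c) Λ·θ²` for every `0 < ε ≤ 1`, `0 < θ ≤ 1 ≤ c`, `0 ≤ β ≤ 1`, `L ≤ Λ`, `1 ≤ Λ`,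
`0 ≤ (d−1)(L−1) ≤ c` — the hypotheses of `exists_windowData_unitRel_eps` are jointly satisfiable. -/
example (L : ℕ) (z : Site d) {β θ ε c Λ : ℝ} (hε : 0 < ε) (hε1 : ε ≤ 1) (hθ : 0 < θ) (hθ1 : θ ≤ 1)
    (hβ0 : 0 ≤ β) (hβ1 : β ≤ 1) (hc1 : 1 ≤ c) (hΛ : 1 ≤ Λ) (hL : (L : ℝ) ≤ Λ)
    (hC0 : 0 ≤ ((d : ℝ) - 1) * ((L : ℝ) - 1)) (hC : ((d : ℝ) - 1) * ((L : ℝ) - 1) ≤ c) :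
    ∃ bw : Win, WindowData L z β (blockDev L z (combGauge (fun _ _ => (1 : Rˣ)) (fun _ _ => expUnit 0 * 1) z)
      (fun _ _ => (1 : Rˣ)) (fun _ _ => expUnit 0 * 1)) bw ∧
      winN unitWin bw ≤ ε * sockConst (16 * relConst c) Λ * θ ^ 2 :=
  exists_windowData_unitRel_eps hε hε1 hθ hθ1 hβ0 hβ1 hc1 hΛ hL hC0 (fun _ _ => unitaryLike_one)
    (fun _ _ => unitaryLike_expUnit_zero.mul unitaryLike_one) (isExpRelOn_zero L z) (relSups_one_zero L z)
    (dictRE_zero hε.le hθ.le (zero_le_one.trans hc1) hC)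

/-- [folklore] THE (COVARIANT) RELATIVE FEED IMPLIES THE SIX-LETTER FEED's per-pair content, which implies the
SEVEN-LETTER one (`RelSupsCov.toRelSups` ∕ `DictRE.plainOfCov`, `RawSups₆.of_rel` ∕ `DictRE.lift`, then
`RawSups₆.lift` ∕ `Dict₆E.lift`): the chain of sockets covariant-relative ⟹ relative ⟹ six letters ⟹ seven letters
⟹ (§6 of `T4CombWindowSocket`) twelve letters ⟹ window. -/
example {U₀ U₁ : Cfg d R} {A : Site d → Fin d → R} {θ ε c C : ℝ} {r : RelLetters} (hε : 0 < ε) (hε1 : ε ≤ 1)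
    (hθ : 0 < θ) (hθ1 : θ ≤ 1) (hc1 : 1 ≤ c) (hu₀ : ∀ x ν, UnitaryLike (U₀ x ν))
    (hu₁ : ∀ x ν, UnitaryLike (U₁ x ν)) (he : IsExpRelOn L z U₀ U₁ A) (h : RelSupsCov L z U₀ A r)
    (hD : DictRE θ ε c C r) :
    RawSups₇ L z U₀ U₁ r.plainOfCov.lift₆.lift₇ ∧
      Dict₇E θ ε (2 * relConst (c * (1 + 2 * c))) C r.plainOfCov.lift₆.lift₇ := by
  have hc0 : (0 : ℝ) ≤ c := by linarith
  have hcc : c ≤ c * (1 + 2 * c) := by nlinarith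
  have hK0 : (0 : ℝ) ≤ relConst (c * (1 + 2 * c)) := zero_le_one.trans (one_le_relConst (hc1.trans hcc))
  exact ⟨(RawSups₆.of_rel hu₀ hu₁ he (h.toRelSups hu₀)).lift,
    ((hD.plainOfCov hε.le hε1 hθ.le hc0 h.nonneg).lift hε hε1 hθ hθ1 (hc1.trans hcc) h.nonneg.plainOfCov).lift
      hε.le hθ.le hK0⟩

end RelWitness

end Literature.MathematicalPhysics.QuantumFieldTheory.Balaban1983to89.T4CombPotentialLetters
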